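import Summits.HodgeConjecture.HodgeConjecture.Theses.HCCMUnconditional
import Summits.HodgeConjecture.HodgeConjecture.Theorems.HLiu418E1Theta
import Summits.HodgeConjecture.HodgeConjecture.Theorems.HLiu418E1TwoFaces
import Summits.HodgeConjecture.HodgeConjecture.Theorems.HLiu418E1Criterion
import Summits.HodgeConjecture.HodgeConjecture.Theorems.HLiu418E3Necessity
import Summits.HodgeConjecture.HodgeConjecture.Theorems.F0P5PaydownStubRelabelUnit
import Summits.HodgeConjecture.HodgeConjecture.Theorems.F0P5CurveThetaStubRelabelParity
import Summits.HodgeConjecture.HodgeConjecture.Theorems.F0P5CurveThetaCompanionDetTwistRep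
import Summits.HodgeConjecture.HodgeConjecture.Theorems.F0P5CurveThetaCompanionRelabelOfLocalFactors
import Summits.HodgeConjecture.HodgeConjecture.Theorems.F0P5CurveThetaCompanionRelabelOfNonsplitIfLetter
import Summits.HodgeConjecture.HodgeConjecture.Theorems.F0P5LemD14IfNonsplitLetter
import Literature.NumberTheory.Automorphic.Liu2021.LemD1RankTwoCMLetters
import Literature.NumberTheory.Automorphic.Liu2021.CheckOfChiCompanionCharacter
import Literature.NumberTheory.Rogawski1990.CurveThetaHodgeTypeNecessity
import Literature.NumberTheory.Rogawski1990.CurveThetaCohFinComponentUnique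
import Literature.NumberTheory.Automorphic.AdelicCommutativeDatumMultiplicityOne
import Literature.NumberTheory.Automorphic.AdelicUnitaryGroupDatum
import Literature.NumberTheory.Automorphic.IdeleClassCharacterConjugate
import Literature.NumberTheory.Automorphic.Liu2021.Def412AdmissibleIffParity
import Literature.NumberTheory.Automorphic.Liu2021.LocalNormClassFlip
import Literature.NumberTheory.ComplexMultiplication.CMTypeBasic
import Literature.NumberTheory.GelbartRogawski1991.Prop311PrintedCML2
import Literature.NumberTheory.Rogawski1990.GlobalPackets
import Literature.NumberTheory.Automorphic.Liu2021.Def411WeilCarriersDoublingDetTwist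
import Literature.NumberTheory.Automorphic.Liu2021.Def411WeilCarriersChiUnitary
import Literature.NumberTheory.GelbartRogawski1991.UnitaryDualPairWeilCoinvariantsTwist
import Literature.NumberTheory.Automorphic.UnitaryGroupAdelicDet
import Literature.NumberTheory.Automorphic.NormOneIdeleClassCompact
import HarnessLib

/-!
# `F0_P5_CurveThetaLettersPaydown` — HCML FLOOR-0 P5 (Alb-CM): the PAY-DOWN LINE of the two curve-theta letters #73 ∕ #74

Crux `HLiu418` (item `stmt-HodgeConjecture-24832`; socket `F0H415`, item 27458), line of record `Lines/F0_AlbCm.lean` ED. 10 (2daec4b8a272):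
its two open print stubs are the booked letters

* #73 `stub_S1_facts  : Literature.NumberTheory.Rogawski1990.curveThetaCohFinComponentUnique_hol` (E1θhol₂, [Liu2021, Prop. D.4 (1)]),
* #74 `stub_S1b_facts : Literature.NumberTheory.Rogawski1990.curveThetaHodgeTypeNecessity_hol` (E3nec-hol₂, [Liu2021, Rem. D.5 «only if»]).

This file is the s554-format PAY-DOWN SKELETON of both letters: it proves the two heads BY NAME

* `curveThetaCohFinComponentUnique_hol_holds : curveThetaCohFinComponentUnique_hol`,
* `curveThetaHodgeTypeNecessity_hol_holds : curveThetaHodgeTypeNecessity_hol`,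

from named stubs (`theorem stub_* …`; after ED. 6 four are `sorry` — G1, G2 and the two AS-PRINTED NON-SPLIT LETTERS L4, L1ns — the only `sorry`s of the file;
R1, A, R2G are closed ★, L1 (all places) is PROVED from L1ns by ★ `LemD1_1AsPrintedNonsplitCM₂.toAllPlaces`, and R2′ is PROVED from the ★ P1 assembler applied to
L4, L1; the P2 reduction R2G + R2″ ⇒ R2′ stays as a proved theorem, R2″ is retired), split LOCAL ∕ GLOBAL as ruled in r139 (c)
(F0/P2 bus l. 998: local stubs are statements about genuine local ∕ arithmetic objects, the automorphic input sits in the global stubs, no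
envelope members), with the glue PROVED here.

## Idea (one paragraph)

[Liu2021, App. D] proves both letters on the THETA road.  #73 is «multiplicity one»: two `(1,0)`-type discrete constituents of
`L²(U(V)(F)\U(V)(𝔸_F))` with the same θ-type finite component coincide — it follows (SPEC ED. 11 v2.1 fold, copied below and PROVED) from the
θ-relative multiplicity bound **G1** «the right-regular multiplicity of such a `P` is `≤ 1`» ([Liu2021, proof of Prop. D.4 (1), p. 130]:
inner transfer [Harris1993] to the quasi-split `U(W*)` + [Rogawski1990, Thm. 11.5.1] ∕ Arthur's multiplicity formula; = [KalethaMinguezShinWhite2014, Thm. 1.7.1]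
at `N = 2`).  #74 is the NECESSITY half of [Liu2021, Rem. D.5] for an UNPINNED label `λ`: Liu states Rem. D.5 for the label of Prop. D.4 (1),
i.e. with `τ′₁ ∈ Φ_μ` («pinned»); the unpinned letter follows from the pinned statement **G2** applied to the OTHER label `(λᶜχ̌, ε_{a′}, χ)` of the
same finite component — [Liu2021, Lem. D.1 (4)] (p. 126): at `n = 2`, `ω_v(λᶜχ̌, ε′, χ) ≅ ω_v(λ, ε, χ)` iff `ε′_v = ε_v` at the isotropic places and
`ε′_v ≠ ε_v` at the anisotropic places of `V_v` (**R2′**, the local lemma assembled over the finite places, stated existentially over the companion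
label with its CM type pinned to `Φ̄_λ`; **R1**, the existence of a GLOBAL unit
`a′` with these local classes, [Omeara1963, 71:19]) — and the parity computation **A** («`Φ` admissible for `ε_a` and the flip exactly on the
anisotropic set force `Φ̄` NOT admissible for `ε_{a′}`», Hilbert reciprocity ★ `even_ncard_not_isIsotropic_add_finrank_sub_one` + [Liu2021, Def. 4.12]
★ `isAdmissible_epsOf_iff_even`; ★-adjacent to `RemD5.not_isAdmissible_companion_of_ne_on_anisotropic`): if `e♮ ∉ Φ_λ` then `e♮ ∈ Φ_{λᶜχ̌} = Φ̄_λ`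
(★ `IsConjugateSymplectic.cmType_galConj_mul_unitaryClassChar_checkOfChi`), G2 at `(λᶜχ̌, a′)` gives «`Φ̄_λ` admissible for `ε_{a′}`», contradicting A.

EDITION 2 (2026-08-31): R1 and A are CLOSED BY NAME (★ p826614 `F0P5PaydownStubRelabelUnit`, ★ p826681 `F0P5CurveThetaStubRelabelParity`, folded by
import; sorries 5 → 3); R2 is REPAIRED to R2′ `CompanionRelabelTransfer₂` per F0P5-ref2 OBJECTION 1 (ED. 1 relabelled to `λᶜ` — a misreading of
[Liu2021, Lem. D.1 (4)] «μ′ = μᶜχ̌»; false on paper wherever `χ̌_v ≠ 1`); bib keys cured per lit1 (KalethaMinguezShinWhite2014, Omeara1963).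

EDITION 3 (2026-08-31): R2′ is SPLIT below its (unchanged) statement, following B-p08 (g21)'s ROUTE-G reconnaissance (memo
`F0/P5/B-p08/g21/R2prime-routeG-recon.B-p08g21.md` c43e910bdff869b1, REF-read ref2 (g17) l33): the LABEL half of [Liu2021, Lem. D.1 (4)] is GLOBAL — the
companion `λᶜ·χ̌` is an explicit determinant twist of THE doubling splitting (★ `chiSplittingLine_mul_ratioHecke`, ★ `weilCoinvTwistEquiv`), giving ONE
named intertwiner `ω_f(λᶜχ̌, ε, χ) ≅ (α_f ∘ det_V) ⊗ Ω_f[λ](ε, χ♭)` (**R2G** `CompanionDetTwist₂`, prover-payable); the LINE half (the flip `ε_a ↦ ε_{a′}`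
changes the dual-pair datum, no transport exists at the anisotropic places) is the per-place packet content of Lem. D.1 (4) at ONE splitting family
(**R2″** `FlipTransferTwisted₂`, typer-first ROUTE P on the θ-package local factors ★ `exists_isRestrictedTensorProductRep_chiSplittingLine_omegaPi_center`);
`stub_sl_companionRelabelTransfer` is now PROVED from the two (`companionRelabelTransfer_of_detTwist_of_flip`, B-p08's composition, kernel-checked).
Caveat C: `χ♭ = χ·α_f⁻²` is NOT automorphic (`∉ Chi`), so the twisted carriers are the bare `TwistedCoinv.Coinv … (lineChar a χ♭)` terms.

EDITION 4 (2026-08-31): R2G is CLOSED BY NAME — ★ `Theorems/F0P5CurveThetaCompanionDetTwistRep.lean` (B-p04 (g30), row R2′-G1; on top of ★ p828480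
`Theorems/F0P5CurveThetaCompanionDetTwist.lean`, B-p08 (g21): `α`, (T1) `toHeckeCharacter_galConj_mul_checkOfChi_eq_mul_ratioHecke`) proves
`stub_sl_companionDetTwist_holds : ‹body of CompanionDetTwist₂›` sorry-free ((T2) ★ `chiSplittingLine_mul_ratioHecke`, (T3) transport along the splitting
equality, (T4) ★ `weilCoinvTwistEquiv(_weilCoinv)`), folded here by import: `stub_sl_companionDetTwist := F0P5CurveThetaCompanionDetTwist.stub_sl_companionDetTwist_holds`;
sorries 4 → 3 (G1, G2, R2″).  The per-place cite behind R2″ is now BY NAME ★ `LemD1_4AsPrintedI (localIndexedFamilyAtV₂ … v)` (p828940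
`Liu2021/LemD1Item4AsPrintedIndexed.lean`, read through ★ `lemD1_4_localFactors_of_lemD1_4AsPrintedI₂`); no statement of this file changed.

EDITION 5 (2026-08-31): ROUTE P1 FOLD.  ★ p830748 `Theorems/F0P5CurveThetaCompanionRelabelOfLocalFactors.lean` (A-p17 (g18), commit 51690182d0cf) proves
`companionRelabelTransfer₂_of_nonsplit_lemD1_4 (h4) (h1) : ‹body of CompanionRelabelTransfer₂›` sorry-free from two AS-PRINTED LETTERS — `h4` =
[Liu2021, Lem. D.1 (4)] (READING I3, ★ `LemD1_4AsPrintedI`) on the two-member indexed family `(λ, a, χ)`, `(λ′, a′, χ)` of θ-package local factors at the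
NON-SPLIT finite places, `h1` = [Liu2021, Lem. D.1 (1)] on ★ `localLemD1DataAtV₂ … a′ … λ′ … χ v` at every finite place — over ★ R2′-J
`CheckOfChi.muOf_localMu_eq_muTwist` (B-p04 (g30)), ★ L1 `sameClass_epsLine_iff_locF_apply_eq` (A-p17 (g18)), ★ split node
`areIsomorphicRep_localFactor_comp_localLineInl_of_split` (B-p08 (g22), GL₂ Weyl symmetry ★ `areIsomorphicRep_parabolicIndGL_two_swap`), ★ gluing
`exists_equiv_rhoVAtLine_of_forall_areIsomorphicRep_localFactor_of_lemD1_1AsPrinted` (A-p18 (g22), Flath ★ `RestrictedTensorProductLocalTransportRankOne`,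
A-p17 (g17)).  The letters are registered here BY NAME as the named Props of ★ p830924 `Liu2021/LemD1RankTwoCMLetters.lean` (B-typ04 (g18), row R2′-L, commit
75c9ca2679; bodies = the assembler's binder types `h4` ∕ `h1` token-for-token outside four inlined plumbing proofs, definitionally equal — desk δ-probe):
NEW stubs `stub_letter_lemD14_nonsplit : LemD1RankTwoCMLetters.LemD1_4AsPrintedNonsplitCM₂`, `stub_letter_lemD11 : LemD1RankTwoCMLetters.LemD1_1AsPrintedCM₂`;
`stub_sl_companionRelabelTransfer := companionRelabelTransfer₂_of_nonsplit_lemD1_4 stub_letter_lemD14_nonsplit stub_letter_lemD11` (δ-unfold); R2″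
`stub_loc_flipTransferTwisted` is RETIRED (its `sorry` removed; `FlipTransferTwisted₂` and the proved P2 composition `companionRelabelTransfer_of_detTwist_of_flip`
are kept as theorems, unused by the heads); NEW certificate `paydownCertificate₇₄Letters` «G2, L4, L1, R1, A imply #74».  sorries 3 → 4, all of them now
typer-first GLOBAL statements (G1, G2) or PRINTED LOCAL LEMMAS VERBATIM (L4, L1); no statement of an existing decl changed.

EDITION 6 (2026-08-31): THE `h1` CUT — letter (1) restricted to the NON-SPLIT places.  ★ p831213 (R2′-L ED. 2, B-typ04 (g18), commit 62d7bc4f6284)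
adds the third named Prop `LemD1RankTwoCMLetters.LemD1_1AsPrintedNonsplitCM₂` ([Liu2021, Lem. D.1 (1)] AS PRINTED at the finite places `v` of `L⁺`
NON-SPLIT in `L` only) and PROVES `LemD1_1AsPrintedNonsplitCM₂.toAllPlaces : LemD1_1AsPrintedNonsplitCM₂ → LemD1_1AsPrintedCM₂` (the split half of
item (1) is the in-house theorem ★ `lemD1_1AsPrinted_localLemD1DataAtV₂_cmFinLocalFamily_of_split`, A-p18 (g22) p830883, on ★ B-p04 (g30) p830397
`…_of_not_isField`; `lemD1_1AsPrintedCM₂_iff_nonsplit`).  NEW stub `stub_letter_lemD11_nonsplit : LemD1RankTwoCMLetters.LemD1_1AsPrintedNonsplitCM₂` (L1ns);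
the ED. 5 stub L1 `stub_letter_lemD11 : ….LemD1_1AsPrintedCM₂` is now CLOSED BY COMPOSITION `:= LemD1_1AsPrintedNonsplitCM₂.toAllPlaces stub_letter_lemD11_nonsplit`
(statement unchanged, `sorry` removed); NEW certificate `paydownCertificate₇₄LettersNonsplit` «G2, L4, L1ns, R1, A imply #74» (TRIO).  sorries 4 → 4 =
{G1, G2, L4, L1ns}: both open letters are now [Liu2021, Lem. D.1 (1) ∕ (4)] AT THE NON-SPLIT PLACES ONLY; no statement of an existing decl changed, no decl removed.

EDITION 7 (2026-08-31): THE L4 SWAP AND THE L1 ELIMINATION.  (i) L1 ELIMINATION (A-p18 (g22)): the R2′ assembly consumes letter (1) only through its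
FIRST SENTENCE (irreducible-or-zero ∧ admissible: ★ p830194 → ★ p830103 §1), never through item (1) proper, and the first sentence is now IN-HOUSE at
EVERY finite place for the CM θ-package — non-split places ★ p831759 `isIrreducibleOrZero_and_isAdmissible_localLemD1DataAtV₂_of_isField` (B-typ04 (g18),
over the PROVED MVW IV.4 facts ★ `mvw_IV4_rankOne_irreducibleOrZero_holds` ∕ `mvw_IV4_rankOne_admissible_holds`), split places ★ p830397 ∕ p830883; glued
hypothesis-free in ★ p831839 + ★ p831988 `exists_equiv_rhoVAtLine_of_forall_areIsomorphicRep_localFactor_cm` (A-p18 (g22)).  Hence the stubs L1ns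
`stub_letter_lemD11_nonsplit` and L1 `stub_letter_lemD11` are RETIRED (decls removed; their letter Props ★ `LemD1_1AsPrintedNonsplitCM₂` ∕ `LemD1_1AsPrintedCM₂`
stay in Literature and as hypotheses of the kept certificates `paydownCertificate₇₄Letters` ∕ `₇₄LettersNonsplit`).  (ii) L4 SWAP: ★ p832219 (R2′-L ED. 3,
B-typ04 (g18)) adds the generic predicate `LemD1_4IfAsPrintedI` (the «if» direction, SECOND alternative, of [Liu2021, Lem. D.1 (4)] READING I3: the twist
relation `μ_j = μ_i·χ_i ∘ det`, `χ_j = χ_i`, `[ε_j] = [ε_i] ↔ V isotropic` implies `Θ_j ≅ Θ_i` for non-zero `Θ_i`), the fifth named Prop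
`LemD1RankTwoCMLetters.LemD1_4IfAsPrintedNonsplitCM₂` (binders of `LemD1_4AsPrintedNonsplitCM₂` verbatim) and PROVES `LemD1_4AsPrintedNonsplitCM₂.toIf`; ★ p832500
`Theorems/F0P5CurveThetaCompanionRelabelOfNonsplitIfLetter.lean` (A-p17 (g18)) `companionRelabelTransfer₂_of_nonsplit_if_letter (h4if)` concludes the
registered body `CompanionRelabelTransfer₂` from that ONE letter.  NEW stub `stub_letter_lemD14_if_nonsplit : LemD1RankTwoCMLetters.LemD1_4IfAsPrintedNonsplitCM₂` (L4if);
`stub_sl_companionRelabelTransfer := F0P5CurveThetaCompanionRelabelOfNonsplitIfLetter.companionRelabelTransfer₂_of_nonsplit_if_letter stub_letter_lemD14_if_nonsplit`; the full-(4) stub L4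
`stub_letter_lemD14_nonsplit` is RETIRED (decl removed; its Prop stays a hypothesis of the kept ED. 5∕6 certificates); NEW certificate `paydownCertificate₇₄IfLetter`
«G2, L4if, R1, A imply #74» (TRIO) and the monotonicity `paydownCertificate₇₄LettersNonsplit_of_ifLetter` (the ED. 6 leaves imply the ED. 7 leaves by ★ `toIf`).
sorries 4 → 3 = {G1, G2, L4if}: the ONLY local printed input left under #74 is the rank-one theta dichotomy at the non-split places
[HarrisKudlaSweet1996, Thm. 6.1] in the currency of [Liu2021, Lem. D.1 (4)] «if»; no statement of a kept decl changed.

EDITION 8 (2026-09-01): THE L4if LETTER PAID BY NAME.  ★ p840716 `Theorems/F0P5LemD14IfNonsplitLetter.lean` (A-p17 (g20); over ★ (C4bΘ) p840569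
`Theorems/F0P5LemD14IfGaloisSimilitudeTheta` (A-p18 (g24)), ★ (P1) p840133 `Theorems/F0P5LemD14IfTwistedTransportGlue`, ★ (P2) p840161
`Theorems/F0P5LemD14IfNonsplitLetterOfCore`, ★ `Theorems/F0P5CurveThetaCompanionGalConjCoinvariants` ∕ `…DetScalarDictionary` and the ★ Literature pieces
`GelbartRogawski1991/LocalGaloisConjCoinvariants` ∕ `…/LocalSplittingCMGaloisTransport`) PROVES `F0P5LemD14IfNonsplitLetter.lemD1_4IfAsPrintedNonsplitCM₂_holds :
LemD1RankTwoCMLetters.LemD1_4IfAsPrintedNonsplitCM₂` WITHOUT hypotheses: at a non-split place the two θ-package members `(λ, a, χ)`, `(λ′, a′, χ)` are linked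
through the twisted transports at `b := −(a·D)⁻¹`, `u := (a·D)⁻¹` (`core_link_iv`), i.e. the rank-one theta dichotomy [HarrisKudlaSweet1996, Thm. 6.1] in the
currency of [Liu2021, Lem. D.1 (4)] «if» is now IN-HOUSE for the CM θ-package.  The stub L4if `stub_letter_lemD14_if_nonsplit` is CLOSED BY NAME
`:= F0P5LemD14IfNonsplitLetter.lemD1_4IfAsPrintedNonsplitCM₂_holds` (statement unchanged, `sorry` removed; the decl is kept so that `stub_sl_companionRelabelTransfer`
and the certificates read as before).  sorries 3 → 2 = {G1, G2}: NO LOCAL printed input is left under #73 ∕ #74 — the open leaves are the two GLOBAL stubs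
(G1 under #73; G2 under #74, with R1, A, R2G, R2′, L4if closed ★); no statement of a kept decl changed, no decl removed, one import added.

## Stubs (registered; LOCAL ∕ GLOBAL split)

* GLOBAL, typer-first (T4 + T5-D1): `stub_glob_multLeOneAtThetaHol : MultLeOneAtThetaHol₂` — SPEC ED. 11 v2.1 `MultLeOneAtThetaHol` verbatim.
* GLOBAL, typer-first (T5-D1 «th:pole» + T5-D2 [Liu2021, Lem. D.2 (3)]): `stub_glob_pinnedHolNecessity : PinnedHolNecessity₂` — [Liu2021, Rem. D.5]
  AS PRINTED (pinned label), necessity direction, in the letters' currency.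
* SEMI-LOCAL, PROVED (ED. 7: ★ assembler `companionRelabelTransfer₂_of_nonsplit_if_letter` applied to L4if; ED. 5∕6: `companionRelabelTransfer₂_of_nonsplit_lemD1_4` on L4, L1; ED. 3∕4: from R2G + R2″): `stub_sl_companionRelabelTransfer : CompanionRelabelTransfer₂` — [Liu2021, Lem. D.1 (4)] with the
  printed companion label `λᶜ·χ̌` (★ `CheckOfChiCompanionCharacter`), in GLOBAL-CARRIER currency, existential over the label.
* GLOBAL det-twist, CLOSED ★ (ED. 4; row R2′-G1, B-p08 (g21) §1 ★ p828480 + B-p04 (g30) `F0P5CurveThetaCompanionDetTwistRep`): `stub_sl_companionDetTwist :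
  CompanionDetTwist₂` — `ω_f(λ′, ε, χ) ≅ (α_f∘det_V) ⊗ Ω_f[λ](ε, χ♭)` for any `λ′` with `toHeckeCharacter λ′ = (toHeckeCharacter λ)ᶜ·χ̌` (★ inputs only).
* LOCAL LETTER, CLOSED ★ (ED. 8: ★ p840716 `Theorems/F0P5LemD14IfNonsplitLetter` BY NAME; ED. 7: PRINTED STATEMENT, row R2′-L ★ `Liu2021/LemD1RankTwoCMLetters.lean` ED. 3): `stub_letter_lemD14_if_nonsplit :
  LemD1RankTwoCMLetters.LemD1_4IfAsPrintedNonsplitCM₂` — [Liu2021, Lem. D.1 (4)] «if» direction, second alternative, at `n = 2`, non-split finite places, on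
  the two θ-package members (= [HarrisKudlaSweet1996, Thm. 6.1] in Liu's currency).  RETIRED: L4 `stub_letter_lemD14_nonsplit` (full (4), ED. 5–6), L1ns
  `stub_letter_lemD11_nonsplit` and L1 `stub_letter_lemD11` (letter (1), ED. 5–6; its first sentence is in-house ★ at every place, item (1) proper is not
  consumed), R2″ `stub_loc_flipTransferTwisted` (ED. 3∕4; the def and the P2 composition stay as proved, unused theorems).
* ARITHMETIC, CLOSED ★ (ED. 2): `stub_arith_relabelUnit : RelabelUnit₂` ([Omeara1963, 71:19] ★ `QuadraticForms.exists_prescribed_normClass_sign_iff_even`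
  + ★ `LemD1OfPlace.finite_setOf_not_isIsotropic`) and `stub_arith_relabelParity : RelabelParity₂` (★ `RemD5.not_isAdmissible_companion_of_ne_on_anisotropic`
  up to ★ `isAdmissibleElement_conj_neg_iff` ∕ `CMTypeOps.bar_bar`).

KERNEL ONLY otherwise: no `def` except the CLOSED `Prop` telescopes of the stubs and certificates, no instance ∕ notation ∕ axiom, no new letter, no MOD text;
net letters 0.  HONEST LABEL: HC_CM is proved only modulo the printed citations — the 2 remaining named inputs (hLiu418, h413), behind them the
booked printed statements + the MOD package — until rung 0 closes; this file pays nothing down until its stubs close.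

## References
* [Liu2021] Y. Liu, *Fourier–Jacobi cycles and arithmetic relative trace formula*, Camb. J. Math. 9 (2021) = arXiv:2102.11518: App. D,
  Lem. D.1 (1), (4) (p. 125–126, proof p. 126–127), Lem. D.2 (3) (p. 127, proof p. 127–128), Def. D.3, Prop. D.4 (1) and its proof (p. 130–131), Rem. D.5 (p. 131); Def. 4.12.
* [Rogawski1990] J. Rogawski, *Automorphic representations of unitary groups in three variables*, Ann. of Math. Stud. 123: §11.1, Thm. 11.5.1.
* [Harris1993] M. Harris, *L-functions of 2×2 unitary groups and factorization of periods of Hilbert modular forms*, JAMS 6 (1993).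
* [KalethaMinguezShinWhite2014] T. Kaletha, A. Minguez, S. W. Shin, P.-J. White, *Endoscopic classification of representations: inner forms of unitary groups*, arXiv:1409.3731, Thm. 1.7.1.
* [HarrisKudlaSweet1996] Harris–Kudla–Sweet, JAMS 9 (1996), Thm. 6.1.
* [GelbartRogawski1991] S. Gelbart, J. Rogawski, *L-functions and Fourier–Jacobi coefficients for the unitary group U(3)*, Invent. Math. 105 (1991): Prop. 3.1.1, Remark p. 457.
* [Omeara1963] O. T. O'Meara, *Introduction to Quadratic Forms* (1963), §71 Thm. 71:18, 71:19.
-/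

set_option autoImplicit false
set_option linter.dupNamespace false

noncomputable section

open NumberField NumberField.InfinitePlace MeasureTheory IsDedekindDomain
open scoped Matrix ComplexOrder
open Literature.NumberTheory.Automorphic Literature.NumberTheory.Automorphic.UnitaryGroup
open Literature.NumberTheory.Automorphic.UnitaryCurveForms
open Literature.NumberTheory.Automorphic.Liu2021 Literature.NumberTheory.Automorphic.Liu2021.Def411WeilCarriers
open Literature.NumberTheory.Automorphic.Liu2021.Def411WeilCarriersDoubling
open Literature.NumberTheory.GaloisRepresentations Literature.NumberTheory.Automorphic.IdeleClassGroup
open Literature.AlgebraicGeometry.Liu2021 (IsAdmissibleElement)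
open Literature.AlgebraicGeometry.Motives (CMType)
open Literature.NumberTheory.ComplexMultiplication (CMTypeOps.bar CMTypeOps.mem_bar_iff)
open Literature.NumberTheory.GelbartRogawski1991 Literature.NumberTheory.GelbartRogawski1991.UnitaryDualPair
open Literature.NumberTheory.GelbartRogawski1991.UnitaryDualPair.WeilCoinv
open Literature.RepresentationTheory (TwistedCoinv.Coinv TwistedCoinv.mk)
open Literature.RepresentationTheory.Liu2021 Literature.RepresentationTheory.HarrisKudlaSweet1996
open Literature.NumberTheory.Rogawski1990

namespace Summit.HodgeConjecture.HodgeConjecture.Cruxes.HLiu418.F0P5CurveThetaLettersPaydown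

-- EDITION 9 (2026-09-02; cand by «LD2» LD2-plan (g0) for the (R3) window of LEAD F0P6-plan (g3) «LD-R1» 03:05:24Z; writer = the rights holder LEAD names):
-- THE ORIENTATION REPAIR.  Letter #74 ★ `curveThetaHodgeTypeNecessity_hol` and G2 `PinnedHolNecessity₂` AS TYPED are false in nature under
-- `(H, t) ↦ (−H, −t)` (LD2-p02 02:43:37Z, LD-ref1 02:53:24Z, class MISSTATED); the re-letter #74R ★ `curveThetaHodgeTypeNecessity_hol_pos` (p848618,
-- EDITION 2 add-only of `Rogawski1990/CurveThetaHodgeTypeNecessity.lean`) carries `(hτt : 0 < (ι t).re) (hτt' : (ι t).im = 0)` after `(ht : t ≠ 0)`.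
-- THIS EDITION: (i) NEW `def PinnedHolNecessity₂'` (G2′ = G2 + the two binders); (ii) stub G2 `stub_glob_pinnedHolNecessity` RE-TYPED `: PinnedHolNecessity₂'`
-- (registered NAME kept, STATEMENT changed — ordered `ledger skeleton check` by the writer); (iii) head `curveThetaHodgeTypeNecessity_hol_pos_holds : …_hol_pos`
-- replaces `…_hol_holds` (the unsigned head is no longer derivable, by design); (iv) NEW certificates `PaydownCertificate₇₄R` ∕ `…₇₄RIfLetter` (sorry-free);
-- (v) §4 `HLiu418_proof` reads `hF0 : #73 → #74R → HLiu418` (= `F0_AlbCm` ED. 11's composition).  UNCHANGED: every `def` of ED. 8 (G2 stays as a settled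
-- negative edge), every ED. 1–8 certificate (true implications), G1 ∕ #73 (orientation-symmetric), R2′ ∕ R1 ∕ A ∕ R2G ∕ L4if (orientation-free, ★).
-- `sorry` count unchanged (G1, G2).  HC_CM is proved only modulo the 7 printed citations (2 remaining: hLiu418 = 24832, h413 = 24833) until rung 0 closes.

/-! ## §1 The five stub statements (closed `Prop` telescopes in the letters' tokens) -/

/-- **G1 (GLOBAL)** — θ-relative multiplicity `≤ 1`: a discrete `P` of Hodge type `(1,0)` at `ι` whose finite component is a θ-type `σ ↪ ω(λ,ε_a,χ)_f`
occurs in `L²` with right-regular multiplicity `≤ 1`.  = SPEC ED. 11 v2.1 `MultLeOneAtThetaHol` VERBATIM.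
[cite: Liu2021, App. D, proof of Prop. D.4 (1) (p. 130–131)] [cite: Rogawski1990, Thm. 11.5.1] [cite: KalethaMinguezShinWhite2014, Thm. 1.7.1] -/
def MultLeOneAtThetaHol₂ : Prop :=
  ∀ (L : Type) [Field L] [NumberField L] [IsCMField L] (ι : L →+* ℂ) (H : Matrix (Fin 2) (Fin 2) L)
    (dV : Fin 2 → L) (hdV : ∀ i, IsCMField.complexConj L (dV i) = dV i) (hdV0 : ∀ i, dV i ≠ 0)
    (t : L) (ht : t ≠ 0) (g : GL (Fin 2) L)
    (hg : formCongr ((IsCMField.complexConj L : L ≃ₐ[↥(maximalRealSubfield L)] L) : L →+* L) g (t • H) = Matrix.diagonal dV),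
    (∃ T : GL (Fin 2) ℂ, formCongr (starRingEnd ℂ) T ((Matrix.diagonal dV).map ι) = Matrix.diagonal ![(1 : ℂ), -1]) →
    (∀ τ' : L →+* ℂ, InfinitePlace.mk τ' ≠ InfinitePlace.mk ι → ((Matrix.diagonal dV).map τ').PosDef) →
    4 ≤ Module.finrank ℚ L →
    ∀ (𝔣 : ConeFrame L H (cmPlace L ι))
      (μ : Measure (adelicGroupData (↥(maximalRealSubfield L)) L (IsCMField.complexConj L) 2 H).automorphicQuotient)
      [(adelicGroupData (↥(maximalRealSubfield L)) L (IsCMField.complexConj L) 2 H).IsAutomorphicMeasure μ]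
      {n' : ℕ} (e₁ : Fin 2 × Fin 1 ≃ Fin n')
      (lam : Literature.NumberTheory.Automorphic.IdeleClassGroup L →ₜ* Circle) (hlam : IsConjugateSymplectic L lam), HasWeight L lam 1 →
    ∀ (a : (↥(maximalRealSubfield L))ˣ) (χ : Chi (↥(maximalRealSubfield L)) L (IsCMField.complexConj L))
      (W : Type) [AddCommGroup W] [Module ℂ W]
      (σ : Representation ℂ (finAdelic (↥(maximalRealSubfield L)) L (IsCMField.complexConj L) 2 H) W),
      σ.IsIrreducible → σ.IsSmooth →
    ∀ j : σ.IntertwiningMap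
        ((rhoVAtLine (↥(maximalRealSubfield L)) L (IsCMField.complexConj L) 2 e₁ (Matrix.diagonal dV)
            (complexConj_imagUnit L) (imagUnit_ne_zero L) (imagUnit_mul_self L) (realDiagonal_isSymm L dV hdV)
            (isUnit_det_realDiagonal L dV hdV hdV0) (realDiagonal_map L dV hdV).symm
            (fun a => isCompatible_chiSplittingLine L e₁ dV hdV hdV0 (toHeckeCharacter L lam)
              (isUnitary_toHeckeCharacter L lam) ((isOscillatorChar_toHeckeCharacter_iff lam).mpr hlam)
              (TW (↥(maximalRealSubfield L)) a) (isSymm_TW (↥(maximalRealSubfield L)) a)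
              (isUnit_det_TW (↥(maximalRealSubfield L)) a) (JW (↥(maximalRealSubfield L)) L a)
              (JW_eq (↥(maximalRealSubfield L)) L a)) a χ).comp
          (finAdelicCongr (↥(maximalRealSubfield L)) L (IsCMField.complexConj L) g ht hg).symm.toMonoidHom),
      Function.Injective j →
    ∀ P : DiscreteAutomorphicRep (adelicGroupData (↥(maximalRealSubfield L)) L (IsCMField.complexConj L) 2 H) μ,
      P.IsHolCotangentAt₂ (IsCMField.complexConj_ne_one L) (UnitaryGroup.complexConj_smul_infinitePlace L) (cmPlace L ι) 𝔣 →
      P.HasFinComponent σ →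
      ((adelicGroupData (↥(maximalRealSubfield L)) L (IsCMField.complexConj L) 2 H).rightRegular μ).multiplicity P.space.toContRep ≤ 1

/-- **G2 (GLOBAL)** — [Liu2021, Rem. D.5] AS PRINTED, necessity direction, with the label PINNED as in [Liu2021, Prop. D.4 (1)] («`τ′₁ ∈ Φ_μ`»):
a `(1,0)`-type occurrence of the θ-type finite component `σ ↪ ω(λ, ε_a, χ)_f` with `e♮ := (cmPlace L ι).1.embedding ∈ Φ_λ` forces «`Φ_λ` is
admissible for `ε_a`» ([Liu2021, Def. 4.12], in the currency of the letters #72–#74).  Print: the proof of Prop. D.4 (1) (inner transfer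
[Harris1993], [Rogawski1990, §11], the pole criterion «th:pole» for a global theta lift from `U(W_e)`) + [Liu2021, Lem. D.2 (3)] (archimedean sign).
[cite: Liu2021, App. D Rem. D.5 (p. 131); Prop. D.4 (1) and its proof (p. 130–131); Lem. D.2 (3); Def. 4.12] [cite: Rogawski1990, Thm. 11.5.1] -/
def PinnedHolNecessity₂ : Prop :=
  ∀ (L : Type) [Field L] [NumberField L] [IsCMField L] (ι : L →+* ℂ) (H : Matrix (Fin 2) (Fin 2) L)
    (dV : Fin 2 → L) (hdV : ∀ i, IsCMField.complexConj L (dV i) = dV i) (hdV0 : ∀ i, dV i ≠ 0)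
    (t : L) (ht : t ≠ 0) (g : GL (Fin 2) L)
    (hg : formCongr ((IsCMField.complexConj L : L ≃ₐ[↥(maximalRealSubfield L)] L) : L →+* L) g (t • H) = Matrix.diagonal dV),
    (∃ T : GL (Fin 2) ℂ, formCongr (starRingEnd ℂ) T ((Matrix.diagonal dV).map ι) = Matrix.diagonal ![(1 : ℂ), -1]) →
    (∀ τ' : L →+* ℂ, InfinitePlace.mk τ' ≠ InfinitePlace.mk ι → ((Matrix.diagonal dV).map τ').PosDef) →
    4 ≤ Module.finrank ℚ L →
    ∀ (𝔣 : ConeFrame L H (cmPlace L ι))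
      (μ : Measure (adelicGroupData (↥(maximalRealSubfield L)) L (IsCMField.complexConj L) 2 H).automorphicQuotient)
      [(adelicGroupData (↥(maximalRealSubfield L)) L (IsCMField.complexConj L) 2 H).IsAutomorphicMeasure μ]
      {n' : ℕ} (e₁ : Fin 2 × Fin 1 ≃ Fin n')
      (lam : Literature.NumberTheory.Automorphic.IdeleClassGroup L →ₜ* Circle) (hlam : IsConjugateSymplectic L lam), HasWeight L lam 1 →
    ∀ (a : (↥(maximalRealSubfield L))ˣ) (χ : Chi (↥(maximalRealSubfield L)) L (IsCMField.complexConj L))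
      (W : Type) [AddCommGroup W] [Module ℂ W]
      (σ : Representation ℂ (finAdelic (↥(maximalRealSubfield L)) L (IsCMField.complexConj L) 2 H) W),
      σ.IsIrreducible → σ.IsSmooth →
    ∀ j : σ.IntertwiningMap
        ((rhoVAtLine (↥(maximalRealSubfield L)) L (IsCMField.complexConj L) 2 e₁ (Matrix.diagonal dV)
            (complexConj_imagUnit L) (imagUnit_ne_zero L) (imagUnit_mul_self L) (realDiagonal_isSymm L dV hdV)
            (isUnit_det_realDiagonal L dV hdV hdV0) (realDiagonal_map L dV hdV).symm
            (fun a => isCompatible_chiSplittingLine L e₁ dV hdV hdV0 (toHeckeCharacter L lam)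
              (isUnitary_toHeckeCharacter L lam) ((isOscillatorChar_toHeckeCharacter_iff lam).mpr hlam)
              (TW (↥(maximalRealSubfield L)) a) (isSymm_TW (↥(maximalRealSubfield L)) a)
              (isUnit_det_TW (↥(maximalRealSubfield L)) a) (JW (↥(maximalRealSubfield L)) L a)
              (JW_eq (↥(maximalRealSubfield L)) L a)) a χ).comp
          (finAdelicCongr (↥(maximalRealSubfield L)) L (IsCMField.complexConj L) g ht hg).symm.toMonoidHom),
      Function.Injective j →
    (cmPlace L ι).1.embedding ∈ hlam.cmType.1 →
    ∀ P : DiscreteAutomorphicRep (adelicGroupData (↥(maximalRealSubfield L)) L (IsCMField.complexConj L) 2 H) μ,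
      P.IsHolCotangentAt₂ (IsCMField.complexConj_ne_one L) (UnitaryGroup.complexConj_smul_infinitePlace L) (cmPlace L ι) 𝔣 →
      P.HasFinComponent σ →
      ∃ e : L, IsAdmissibleElement L hlam.cmType.1 e ∧
        epsOf (↥(maximalRealSubfield L)) (imagUnitSq L) L (2 * imagUnit L)⁻¹ e = locF (↥(maximalRealSubfield L)) (imagUnitSq L) a


/-- **G2′ (GLOBAL, ORIENTED; EDITION 9)** — G2 WITH THE TWO ORIENTATION BINDERS `(hτt : 0 < (ι t).re) (hτt' : (ι t).im = 0)` inserted after `(ht : t ≠ 0)`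
(token for token otherwise): [Liu2021, Rem. D.5] necessity direction with the label PINNED (`e♮ ∈ Φ_λ`), for Liu's `V := t • H` with `t` POSITIVE at `ι`.
G2 as typed (above, kept as a settled negative edge) falls with letter #74 under `(H, t) ↦ (−H, −t)` (LD2-p02 02:43:37Z ∕ LD-ref1 02:53:24Z ∕ LEAD «LD-R1» 03:05:24Z);
G2′ is the statement the cell's LD2 line pays in-house (`Cruxes/HLiu418/Lines` LD2 skeleton, head `pinnedHolNecessity₂'_of_organs` over five organ stubs).
[cite: Liu2021, App. D Rem. D.5 (p. 131); Prop. D.4 (1) and its proof (p. 130–131); Lem. D.2 (3); Def. 4.12] [cite: Rogawski1990, Thm. 11.5.1] -/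
def PinnedHolNecessity₂' : Prop :=
  ∀ (L : Type) [Field L] [NumberField L] [IsCMField L] (ι : L →+* ℂ) (H : Matrix (Fin 2) (Fin 2) L)
    (dV : Fin 2 → L) (hdV : ∀ i, IsCMField.complexConj L (dV i) = dV i) (hdV0 : ∀ i, dV i ≠ 0)
    (t : L) (ht : t ≠ 0) (hτt : 0 < (ι t).re) (hτt' : (ι t).im = 0) (g : GL (Fin 2) L)
    (hg : formCongr ((IsCMField.complexConj L : L ≃ₐ[↥(maximalRealSubfield L)] L) : L →+* L) g (t • H) = Matrix.diagonal dV),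
    (∃ T : GL (Fin 2) ℂ, formCongr (starRingEnd ℂ) T ((Matrix.diagonal dV).map ι) = Matrix.diagonal ![(1 : ℂ), -1]) →
    (∀ τ' : L →+* ℂ, InfinitePlace.mk τ' ≠ InfinitePlace.mk ι → ((Matrix.diagonal dV).map τ').PosDef) →
    4 ≤ Module.finrank ℚ L →
    ∀ (𝔣 : ConeFrame L H (cmPlace L ι))
      (μ : Measure (adelicGroupData (↥(maximalRealSubfield L)) L (IsCMField.complexConj L) 2 H).automorphicQuotient)
      [(adelicGroupData (↥(maximalRealSubfield L)) L (IsCMField.complexConj L) 2 H).IsAutomorphicMeasure μ]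
      {n' : ℕ} (e₁ : Fin 2 × Fin 1 ≃ Fin n')
      (lam : Literature.NumberTheory.Automorphic.IdeleClassGroup L →ₜ* Circle) (hlam : IsConjugateSymplectic L lam), HasWeight L lam 1 →
    ∀ (a : (↥(maximalRealSubfield L))ˣ) (χ : Chi (↥(maximalRealSubfield L)) L (IsCMField.complexConj L))
      (W : Type) [AddCommGroup W] [Module ℂ W]
      (σ : Representation ℂ (finAdelic (↥(maximalRealSubfield L)) L (IsCMField.complexConj L) 2 H) W),
      σ.IsIrreducible → σ.IsSmooth →
    ∀ j : σ.IntertwiningMap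
        ((rhoVAtLine (↥(maximalRealSubfield L)) L (IsCMField.complexConj L) 2 e₁ (Matrix.diagonal dV)
            (complexConj_imagUnit L) (imagUnit_ne_zero L) (imagUnit_mul_self L) (realDiagonal_isSymm L dV hdV)
            (isUnit_det_realDiagonal L dV hdV hdV0) (realDiagonal_map L dV hdV).symm
            (fun a => isCompatible_chiSplittingLine L e₁ dV hdV hdV0 (toHeckeCharacter L lam)
              (isUnitary_toHeckeCharacter L lam) ((isOscillatorChar_toHeckeCharacter_iff lam).mpr hlam)
              (TW (↥(maximalRealSubfield L)) a) (isSymm_TW (↥(maximalRealSubfield L)) a)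
              (isUnit_det_TW (↥(maximalRealSubfield L)) a) (JW (↥(maximalRealSubfield L)) L a)
              (JW_eq (↥(maximalRealSubfield L)) L a)) a χ).comp
          (finAdelicCongr (↥(maximalRealSubfield L)) L (IsCMField.complexConj L) g ht hg).symm.toMonoidHom),
      Function.Injective j →
    (cmPlace L ι).1.embedding ∈ hlam.cmType.1 →
    ∀ P : DiscreteAutomorphicRep (adelicGroupData (↥(maximalRealSubfield L)) L (IsCMField.complexConj L) 2 H) μ,
      P.IsHolCotangentAt₂ (IsCMField.complexConj_ne_one L) (UnitaryGroup.complexConj_smul_infinitePlace L) (cmPlace L ι) 𝔣 →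
      P.HasFinComponent σ →
      ∃ e : L, IsAdmissibleElement L hlam.cmType.1 e ∧
        epsOf (↥(maximalRealSubfield L)) (imagUnitSq L) L (2 * imagUnit L)⁻¹ e = locF (↥(maximalRealSubfield L)) (imagUnitSq L) a

/-- **R2′ (SEMI-LOCAL = [Liu2021, Lem. D.1 (4)] assembled over the finite places, in global-carrier currency; ED. 2, repaired per
F0P5-ref2 OBJECTION 1 2026-08-31T15:14:36Z)** — the COMPANION RELABELLING of a θ-type finite component: if `σ ↪ ω(λ, ε_a, χ)_f` (injective,
`σ` irreducible smooth) then, for every unit `a′` of `L⁺` whose local norm classes differ from those of `a` EXACTLY at the finite places where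
the hermitian plane `(L_v², diag dV ⊗ 1)` is anisotropic, `σ ↪ ω(λ′, ε_{a′}, χ)_f` for SOME conjugate-symplectic weight-one label `λ′` of CM type
`Φ_{λ′} = Φ̄_λ`.  Print: [Liu2021, Lem. D.1 (4)] AS PRINTED (Camb. J. Math. 9, p. 126 L4–6): «`n = 2`, `ω ≠ 0`: `ω(μ′,ε′,χ′) ≅ ω(μ,ε,χ)` iff
`(μ′,ε′,χ′) = (μ,ε,χ)` or **`μ′ = μᶜχ̌`**, `χ′ = χ`, `ε′ = ε` (resp. `≠`) when `V` is isotropic (resp. anisotropic)» — so the printed witness is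
the companion `λ′ := λᶜ·χ̌` = ★ `IdeleClassGroup.galConj 𝔠 λ * unitaryClassChar L (HeckeCharacter.checkOfChi hcc χ) hu`
(★ `CheckOfChiCompanionCharacter`: `IsConjugateSymplectic.galConj_mul_unitaryClassChar_checkOfChi`, `HasWeight.galConj_mul_unitaryClassChar_checkOfChi`,
`IsConjugateSymplectic.cmType_galConj_mul_unitaryClassChar_checkOfChi = CMTypeOps.bar _`; the `_inv` twins if the tree's `χ`-slot of `rhoVAtLine`
reads print's `χ⁻¹` — either twin has CM type `Φ̄_λ`).  The statement is EXISTENTIAL over `λ′` with its CM type pinned to `Φ̄_λ` (all the glue uses),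
hence a consequence of the printed lemma in either χ-orientation; the ED. 1 form with `λ′ = λᶜ` (docstring «μ′ = μᶜ») misread p. 126 and is
FALSE on paper at places with `χ̌_v ≠ 1` (ref2's split-place witness, [Liu2021, p. 126 L7–12]).  Dichotomy [HarrisKudlaSweet1996, Thm. 6.1] at
every finite place + restricted tensor product (or the global Schrödinger model); `ω_v ≠ 0` is forced by the injection.
[cite: Liu2021, App. D Lem. D.1 (1), (4) (p. 125–126) and its proof (p. 126–127); Rem. 4.4] [cite: HarrisKudlaSweet1996, Thm. 6.1] -/
def CompanionRelabelTransfer₂ : Prop :=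
  ∀ (L : Type) [Field L] [NumberField L] [IsCMField L] (ι : L →+* ℂ) (H : Matrix (Fin 2) (Fin 2) L)
    (dV : Fin 2 → L) (hdV : ∀ i, IsCMField.complexConj L (dV i) = dV i) (hdV0 : ∀ i, dV i ≠ 0)
    (t : L) (ht : t ≠ 0) (g : GL (Fin 2) L)
    (hg : formCongr ((IsCMField.complexConj L : L ≃ₐ[↥(maximalRealSubfield L)] L) : L →+* L) g (t • H) = Matrix.diagonal dV),
    (∃ T : GL (Fin 2) ℂ, formCongr (starRingEnd ℂ) T ((Matrix.diagonal dV).map ι) = Matrix.diagonal ![(1 : ℂ), -1]) →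
    (∀ τ' : L →+* ℂ, InfinitePlace.mk τ' ≠ InfinitePlace.mk ι → ((Matrix.diagonal dV).map τ').PosDef) →
    4 ≤ Module.finrank ℚ L →
    ∀ {n' : ℕ} (e₁ : Fin 2 × Fin 1 ≃ Fin n')
      (lam : Literature.NumberTheory.Automorphic.IdeleClassGroup L →ₜ* Circle) (hlam : IsConjugateSymplectic L lam), HasWeight L lam 1 →
    ∀ (a : (↥(maximalRealSubfield L))ˣ) (χ : Chi (↥(maximalRealSubfield L)) L (IsCMField.complexConj L))
      (W : Type) [AddCommGroup W] [Module ℂ W]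
      (σ : Representation ℂ (finAdelic (↥(maximalRealSubfield L)) L (IsCMField.complexConj L) 2 H) W),
      σ.IsIrreducible → σ.IsSmooth →
    ∀ j : σ.IntertwiningMap
        ((rhoVAtLine (↥(maximalRealSubfield L)) L (IsCMField.complexConj L) 2 e₁ (Matrix.diagonal dV)
            (complexConj_imagUnit L) (imagUnit_ne_zero L) (imagUnit_mul_self L) (realDiagonal_isSymm L dV hdV)
            (isUnit_det_realDiagonal L dV hdV hdV0) (realDiagonal_map L dV hdV).symm
            (fun a => isCompatible_chiSplittingLine L e₁ dV hdV hdV0 (toHeckeCharacter L lam)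
              (isUnitary_toHeckeCharacter L lam) ((isOscillatorChar_toHeckeCharacter_iff lam).mpr hlam)
              (TW (↥(maximalRealSubfield L)) a) (isSymm_TW (↥(maximalRealSubfield L)) a)
              (isUnit_det_TW (↥(maximalRealSubfield L)) a) (JW (↥(maximalRealSubfield L)) L a)
              (JW_eq (↥(maximalRealSubfield L)) L a)) a χ).comp
          (finAdelicCongr (↥(maximalRealSubfield L)) L (IsCMField.complexConj L) g ht hg).symm.toMonoidHom),
      Function.Injective j →
    ∀ a' : (↥(maximalRealSubfield L))ˣ,
      (∀ (hJh : ((Matrix.diagonal dV).map (IsCMField.complexConj L))ᵀ = Matrix.diagonal dV) (hJdet : (Matrix.diagonal dV).det ≠ 0)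
          (v : HeightOneSpectrum (𝓞 ↥(maximalRealSubfield L))),
        locF (↥(maximalRealSubfield L)) (imagUnitSq L) a' v = locF (↥(maximalRealSubfield L)) (imagUnitSq L) a v ↔
          LemD1.IsIsotropic (LemD1OfPlace.standingData L v (IsCMField.complexConj L) 2 (Matrix.diagonal dV)
            (complexConj_imagUnit L) (imagUnit_ne_zero L) le_rfl hJh hJdet)) →
      ∃ (lam' : Literature.NumberTheory.Automorphic.IdeleClassGroup L →ₜ* Circle) (hlam' : IsConjugateSymplectic L lam'),
        HasWeight L lam' 1 ∧ hlam'.cmType = CMTypeOps.bar hlam.cmType ∧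
        ∃ j' : σ.IntertwiningMap
            ((rhoVAtLine (↥(maximalRealSubfield L)) L (IsCMField.complexConj L) 2 e₁ (Matrix.diagonal dV)
                (complexConj_imagUnit L) (imagUnit_ne_zero L) (imagUnit_mul_self L) (realDiagonal_isSymm L dV hdV)
                (isUnit_det_realDiagonal L dV hdV hdV0) (realDiagonal_map L dV hdV).symm
                (fun a => isCompatible_chiSplittingLine L e₁ dV hdV hdV0 (toHeckeCharacter L lam') (isUnitary_toHeckeCharacter L lam')
                  ((isOscillatorChar_toHeckeCharacter_iff lam').mpr hlam')
                  (TW (↥(maximalRealSubfield L)) a) (isSymm_TW (↥(maximalRealSubfield L)) a)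
                  (isUnit_det_TW (↥(maximalRealSubfield L)) a) (JW (↥(maximalRealSubfield L)) L a)
                  (JW_eq (↥(maximalRealSubfield L)) L a)) a' χ).comp
              (finAdelicCongr (↥(maximalRealSubfield L)) L (IsCMField.complexConj L) g ht hg).symm.toMonoidHom),
          Function.Injective j'

/-- **R2G (GLOBAL det-twist; support of R2′, rank 9; PROVER row R2′-G1, B-p08 (g21); [GelbartRogawski1991, Remark p. 457] + [Liu2021, App. D Step 2])** — `ω_f(λ′, ε_a, χ) ≅ (α_f ∘ det_V) ⊗ Ω_f[λ](ε_a, χ♭)`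
for ANY `λ′` with `toHeckeCharacter λ′ = (toHeckeCharacter λ)ᶜ · χ̌`, as a linear equivalence carrying the `λ′`-side action to the `λ`-side action
twisted by the scalar `α(det k)`.  Inputs ★: `chiSplittingLine_mul_ratioHecke`, `weilCoinvTwistEquiv(_weilCoinv)`, `isCompatible_twist`.
Statement text = B-p08 (g21) ROUTE-G recon memo §2.4 (T5) at `N′ = 2` (`F0/P5/B-p08/g21/R2prime-routeG-recon.B-p08g21.md` c43e910bdff869b1) ∕ draft
`R2prime-ED3-stubs.draft.B-p08g21.lean` 4ac1b8d99d63980b :111–171, verbatim.  Why it might fail: only by mis-typing — the twist data `α`, `χ♭` are ∀-bound with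
their pointwise specs; `χ♭ ∉ Chi` (Caveat C) so the right-hand carrier is the BARE `TwistedCoinv.Coinv … (lineChar a χf)` term.
[cite: Liu2021, App. D Lem. D.1 (4) (p. 126); App. D §D.1 Step 2; Rem. 4.4] [cite: GelbartRogawski1991, Prop. 3.1.1 p. 455; Remark p. 457] -/
def CompanionDetTwist₂ : Prop :=
  ∀ (L : Type) [Field L] [NumberField L] [IsCMField L]
    (dV : Fin 2 → L) (hdV : ∀ i, IsCMField.complexConj L (dV i) = dV i) (hdV0 : ∀ i, dV i ≠ 0)
    (hJdet : (Matrix.diagonal dV).det ≠ 0)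
    (hcc : IsCMField.complexConj L * IsCMField.complexConj L = 1)
    {n' : ℕ} (e₁ : Fin 2 × Fin 1 ≃ Fin n')
    (lam : Literature.NumberTheory.Automorphic.IdeleClassGroup L →ₜ* Circle) (hlam : IsConjugateSymplectic L lam)
    (χ : Chi (↥(maximalRealSubfield L)) L (IsCMField.complexConj L))
    (lam' : Literature.NumberTheory.Automorphic.IdeleClassGroup L →ₜ* Circle) (hlam' : IsConjugateSymplectic L lam'),
    toHeckeCharacter L lam' =
      toHeckeCharacter L (IdeleClassGroup.galConj (IsCMField.complexConj L) lam) * HeckeCharacter.checkOfChi hcc χ →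
    ∀ (α : UnitaryGroup.adelicOne (↥(maximalRealSubfield L)) L (IsCMField.complexConj L) →* ℂˣ),
      (∀ u, α u = (toHeckeCharacter L lam (u : Literature.NumberTheory.GaloisRepresentations.ideleGroup L))⁻¹ *
          χ.1 ⟨finitePart L (u : Literature.NumberTheory.GaloisRepresentations.ideleGroup L), finitePart_mem_finAdelicOne (↥(maximalRealSubfield L)) L (IsCMField.complexConj L) u.2⟩) →
    ∀ (χf : UnitaryGroup.finAdelicOne (↥(maximalRealSubfield L)) L (IsCMField.complexConj L) →* ℂˣ),
      (∀ v, χf v = χ.1 v *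
          (α ⟨finiteIdele L (v : (FiniteAdeleRing (𝓞 L) L)ˣ), finiteIdele_mem_adelicOne (↥(maximalRealSubfield L)) L (IsCMField.complexConj L) v⟩ ^ 2)⁻¹) →
    ∀ a : (↥(maximalRealSubfield L))ˣ,
    ∃ T : omegaAtLine (↥(maximalRealSubfield L)) L (IsCMField.complexConj L) 2 e₁ (Matrix.diagonal dV)
            (complexConj_imagUnit L) (imagUnit_ne_zero L) (imagUnit_mul_self L) (realDiagonal_isSymm L dV hdV)
            (isUnit_det_realDiagonal L dV hdV hdV0) (realDiagonal_map L dV hdV).symm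
            (fun a => isCompatible_chiSplittingLine L e₁ dV hdV hdV0 (toHeckeCharacter L lam') (isUnitary_toHeckeCharacter L lam')
              ((isOscillatorChar_toHeckeCharacter_iff lam').mpr hlam')
              (TW (↥(maximalRealSubfield L)) a) (isSymm_TW (↥(maximalRealSubfield L)) a)
              (isUnit_det_TW (↥(maximalRealSubfield L)) a) (JW (↥(maximalRealSubfield L)) L a)
              (JW_eq (↥(maximalRealSubfield L)) L a)) a χ ≃ₗ[ℂ]
          TwistedCoinv.Coinv
            (finPairRepW (↥(maximalRealSubfield L)) L (IsCMField.complexConj L) 2 1 e₁ (Matrix.diagonal dV)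
              (JW (↥(maximalRealSubfield L)) L a) (complexConj_imagUnit L) (imagUnit_ne_zero L) (imagUnit_mul_self L)
              (realDiagonal_isSymm L dV hdV) (isSymm_TW (↥(maximalRealSubfield L)) a) (isUnit_det_realDiagonal L dV hdV hdV0)
              (isUnit_det_TW (↥(maximalRealSubfield L)) a) (realDiagonal_map L dV hdV).symm (JW_eq (↥(maximalRealSubfield L)) L a)
              (isCompatible_chiSplittingLine L e₁ dV hdV hdV0 (toHeckeCharacter L lam) (isUnitary_toHeckeCharacter L lam)
                ((isOscillatorChar_toHeckeCharacter_iff lam).mpr hlam)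
                (TW (↥(maximalRealSubfield L)) a) (isSymm_TW (↥(maximalRealSubfield L)) a)
                (isUnit_det_TW (↥(maximalRealSubfield L)) a) (JW (↥(maximalRealSubfield L)) L a)
                (JW_eq (↥(maximalRealSubfield L)) L a)))
            (lineChar (↥(maximalRealSubfield L)) L (IsCMField.complexConj L) a χf),
      ∀ k x, T (rhoVAtLine (↥(maximalRealSubfield L)) L (IsCMField.complexConj L) 2 e₁ (Matrix.diagonal dV)
            (complexConj_imagUnit L) (imagUnit_ne_zero L) (imagUnit_mul_self L) (realDiagonal_isSymm L dV hdV)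
            (isUnit_det_realDiagonal L dV hdV hdV0) (realDiagonal_map L dV hdV).symm
            (fun a => isCompatible_chiSplittingLine L e₁ dV hdV hdV0 (toHeckeCharacter L lam') (isUnitary_toHeckeCharacter L lam')
              ((isOscillatorChar_toHeckeCharacter_iff lam').mpr hlam')
              (TW (↥(maximalRealSubfield L)) a) (isSymm_TW (↥(maximalRealSubfield L)) a)
              (isUnit_det_TW (↥(maximalRealSubfield L)) a) (JW (↥(maximalRealSubfield L)) L a)
              (JW_eq (↥(maximalRealSubfield L)) L a)) a χ k x) =
        ((α (UnitaryGroup.adelicDet (↥(maximalRealSubfield L)) L (IsCMField.complexConj L) 2 (Matrix.diagonal dV) hJdet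
              (UnitaryGroup.finAdelicToAdelic (↥(maximalRealSubfield L)) L (IsCMField.complexConj L) 2 (Matrix.diagonal dV) k)) : ℂˣ) : ℂ) •
          weilCoinv (↥(maximalRealSubfield L)) L (IsCMField.complexConj L) 2 1 e₁ (Matrix.diagonal dV)
            (JW (↥(maximalRealSubfield L)) L a) (complexConj_imagUnit L) (imagUnit_ne_zero L) (imagUnit_mul_self L)
            (realDiagonal_isSymm L dV hdV) (isSymm_TW (↥(maximalRealSubfield L)) a) (isUnit_det_realDiagonal L dV hdV hdV0)
            (isUnit_det_TW (↥(maximalRealSubfield L)) a) (realDiagonal_map L dV hdV).symm (JW_eq (↥(maximalRealSubfield L)) L a)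
            (lineChar (↥(maximalRealSubfield L)) L (IsCMField.complexConj L) a χf)
            (isCompatible_chiSplittingLine L e₁ dV hdV hdV0 (toHeckeCharacter L lam) (isUnitary_toHeckeCharacter L lam)
              ((isOscillatorChar_toHeckeCharacter_iff lam).mpr hlam)
              (TW (↥(maximalRealSubfield L)) a) (isSymm_TW (↥(maximalRealSubfield L)) a)
              (isUnit_det_TW (↥(maximalRealSubfield L)) a) (JW (↥(maximalRealSubfield L)) L a)
              (JW_eq (↥(maximalRealSubfield L)) L a))
            k (T x)

/-- **R2″ (SEMI-LOCAL; crux-grade support of R2′, rank 9; typer-first T5-D2 ROUTE P on the θ-package local factors)** — the LINE FLIP at ONE splitting family: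
«`σ ↪ ω_f(λ, ε_a, χ)` injective ⇒ `σ ↪ (α_f ∘ det_V) ⊗ Ω_f[λ](ε_{a′}, χ♭)` injective» for `a′` flipped exactly on the anisotropic set,
`α`, `χ♭` the det-twist data of R2G (∀-bound with their specs).  = [Liu2021, Lem. D.1 (4)] assembled over the finite places for ONE splitting
package (memo §4); NO companion character. [cite: Liu2021, App. D Lem. D.1 (1), (4) (p. 125–126); Rem. 4.4] [cite: HarrisKudlaSweet1996, Thm. 6.1] -/
def FlipTransferTwisted₂ : Prop :=
  ∀ (L : Type) [Field L] [NumberField L] [IsCMField L] (ι : L →+* ℂ) (H : Matrix (Fin 2) (Fin 2) L)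
    (dV : Fin 2 → L) (hdV : ∀ i, IsCMField.complexConj L (dV i) = dV i) (hdV0 : ∀ i, dV i ≠ 0)
    (t : L) (ht : t ≠ 0) (g : GL (Fin 2) L)
    (hg : formCongr ((IsCMField.complexConj L : L ≃ₐ[↥(maximalRealSubfield L)] L) : L →+* L) g (t • H) = Matrix.diagonal dV),
    (∃ T : GL (Fin 2) ℂ, formCongr (starRingEnd ℂ) T ((Matrix.diagonal dV).map ι) = Matrix.diagonal ![(1 : ℂ), -1]) →
    (∀ τ' : L →+* ℂ, InfinitePlace.mk τ' ≠ InfinitePlace.mk ι → ((Matrix.diagonal dV).map τ').PosDef) →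
    4 ≤ Module.finrank ℚ L →
    ∀ {n' : ℕ} (e₁ : Fin 2 × Fin 1 ≃ Fin n')
      (lam : Literature.NumberTheory.Automorphic.IdeleClassGroup L →ₜ* Circle) (hlam : IsConjugateSymplectic L lam), HasWeight L lam 1 →
    ∀ (a : (↥(maximalRealSubfield L))ˣ) (χ : Chi (↥(maximalRealSubfield L)) L (IsCMField.complexConj L))
      (W : Type) [AddCommGroup W] [Module ℂ W]
      (σ : Representation ℂ (finAdelic (↥(maximalRealSubfield L)) L (IsCMField.complexConj L) 2 H) W),
      σ.IsIrreducible → σ.IsSmooth →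
    ∀ j : σ.IntertwiningMap
        ((rhoVAtLine (↥(maximalRealSubfield L)) L (IsCMField.complexConj L) 2 e₁ (Matrix.diagonal dV)
            (complexConj_imagUnit L) (imagUnit_ne_zero L) (imagUnit_mul_self L) (realDiagonal_isSymm L dV hdV)
            (isUnit_det_realDiagonal L dV hdV hdV0) (realDiagonal_map L dV hdV).symm
            (fun a => isCompatible_chiSplittingLine L e₁ dV hdV hdV0 (toHeckeCharacter L lam)
              (isUnitary_toHeckeCharacter L lam) ((isOscillatorChar_toHeckeCharacter_iff lam).mpr hlam)
              (TW (↥(maximalRealSubfield L)) a) (isSymm_TW (↥(maximalRealSubfield L)) a)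
              (isUnit_det_TW (↥(maximalRealSubfield L)) a) (JW (↥(maximalRealSubfield L)) L a)
              (JW_eq (↥(maximalRealSubfield L)) L a)) a χ).comp
          (finAdelicCongr (↥(maximalRealSubfield L)) L (IsCMField.complexConj L) g ht hg).symm.toMonoidHom),
      Function.Injective j →
    ∀ a' : (↥(maximalRealSubfield L))ˣ,
      (∀ (hJh : ((Matrix.diagonal dV).map (IsCMField.complexConj L))ᵀ = Matrix.diagonal dV) (hJdet : (Matrix.diagonal dV).det ≠ 0)
          (v : HeightOneSpectrum (𝓞 ↥(maximalRealSubfield L))),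
        locF (↥(maximalRealSubfield L)) (imagUnitSq L) a' v = locF (↥(maximalRealSubfield L)) (imagUnitSq L) a v ↔
          LemD1.IsIsotropic (LemD1OfPlace.standingData L v (IsCMField.complexConj L) 2 (Matrix.diagonal dV)
            (complexConj_imagUnit L) (imagUnit_ne_zero L) le_rfl hJh hJdet)) →
    ∀ (hJdet : (Matrix.diagonal dV).det ≠ 0)
      (α : UnitaryGroup.adelicOne (↥(maximalRealSubfield L)) L (IsCMField.complexConj L) →* ℂˣ),
      (∀ u, α u = (toHeckeCharacter L lam (u : Literature.NumberTheory.GaloisRepresentations.ideleGroup L))⁻¹ *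
          χ.1 ⟨finitePart L (u : Literature.NumberTheory.GaloisRepresentations.ideleGroup L), finitePart_mem_finAdelicOne (↥(maximalRealSubfield L)) L (IsCMField.complexConj L) u.2⟩) →
    ∀ (χf : UnitaryGroup.finAdelicOne (↥(maximalRealSubfield L)) L (IsCMField.complexConj L) →* ℂˣ),
      (∀ v, χf v = χ.1 v *
          (α ⟨finiteIdele L (v : (FiniteAdeleRing (𝓞 L) L)ˣ), finiteIdele_mem_adelicOne (↥(maximalRealSubfield L)) L (IsCMField.complexConj L) v⟩ ^ 2)⁻¹) →
    ∃ j'' : W →ₗ[ℂ]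
        TwistedCoinv.Coinv
          (finPairRepW (↥(maximalRealSubfield L)) L (IsCMField.complexConj L) 2 1 e₁ (Matrix.diagonal dV)
            (JW (↥(maximalRealSubfield L)) L a') (complexConj_imagUnit L) (imagUnit_ne_zero L) (imagUnit_mul_self L)
            (realDiagonal_isSymm L dV hdV) (isSymm_TW (↥(maximalRealSubfield L)) a') (isUnit_det_realDiagonal L dV hdV hdV0)
            (isUnit_det_TW (↥(maximalRealSubfield L)) a') (realDiagonal_map L dV hdV).symm (JW_eq (↥(maximalRealSubfield L)) L a')
            (isCompatible_chiSplittingLine L e₁ dV hdV hdV0 (toHeckeCharacter L lam) (isUnitary_toHeckeCharacter L lam)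
              ((isOscillatorChar_toHeckeCharacter_iff lam).mpr hlam)
              (TW (↥(maximalRealSubfield L)) a') (isSymm_TW (↥(maximalRealSubfield L)) a')
              (isUnit_det_TW (↥(maximalRealSubfield L)) a') (JW (↥(maximalRealSubfield L)) L a')
              (JW_eq (↥(maximalRealSubfield L)) L a')))
          (lineChar (↥(maximalRealSubfield L)) L (IsCMField.complexConj L) a' χf),
      Function.Injective j'' ∧
      ∀ k w, j'' (σ k w) =
        ((α (UnitaryGroup.adelicDet (↥(maximalRealSubfield L)) L (IsCMField.complexConj L) 2 (Matrix.diagonal dV) hJdet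
              (UnitaryGroup.finAdelicToAdelic (↥(maximalRealSubfield L)) L (IsCMField.complexConj L) 2 (Matrix.diagonal dV)
                ((finAdelicCongr (↥(maximalRealSubfield L)) L (IsCMField.complexConj L) g ht hg).symm.toMonoidHom k))) : ℂˣ) : ℂ) •
          weilCoinv (↥(maximalRealSubfield L)) L (IsCMField.complexConj L) 2 1 e₁ (Matrix.diagonal dV)
            (JW (↥(maximalRealSubfield L)) L a') (complexConj_imagUnit L) (imagUnit_ne_zero L) (imagUnit_mul_self L)
            (realDiagonal_isSymm L dV hdV) (isSymm_TW (↥(maximalRealSubfield L)) a') (isUnit_det_realDiagonal L dV hdV hdV0)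
            (isUnit_det_TW (↥(maximalRealSubfield L)) a') (realDiagonal_map L dV hdV).symm (JW_eq (↥(maximalRealSubfield L)) L a')
            (lineChar (↥(maximalRealSubfield L)) L (IsCMField.complexConj L) a' χf)
            (isCompatible_chiSplittingLine L e₁ dV hdV hdV0 (toHeckeCharacter L lam) (isUnitary_toHeckeCharacter L lam)
              ((isOscillatorChar_toHeckeCharacter_iff lam).mpr hlam)
              (TW (↥(maximalRealSubfield L)) a') (isSymm_TW (↥(maximalRealSubfield L)) a')
              (isUnit_det_TW (↥(maximalRealSubfield L)) a') (JW (↥(maximalRealSubfield L)) L a')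
              (JW_eq (↥(maximalRealSubfield L)) L a'))
            ((finAdelicCongr (↥(maximalRealSubfield L)) L (IsCMField.complexConj L) g ht hg).symm.toMonoidHom k) (j'' w)

/-- **R1 (ARITHMETIC, local–global)** — the RELABELLING UNIT exists: for the registered frame (`diag dV` of signature `(1,1)` at `ι`, definite
elsewhere, `[L:ℚ] ≥ 4`) and every unit `a` of `L⁺` there is a unit `a′` whose local norm classes `ε_{a′,v} ∈ L⁺_vˣ ⧸ N(L_vˣ)` agree with those
of `a` exactly at the finite places where `(L_v², diag dV ⊗ 1)` is isotropic (the anisotropic set is finite, ★ `LemD1OfPlace.finite_setOf_not_isIsotropic`;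
realise the prescribed finite local classes with free real signs by [Omeara1963, 71:19] ★ `QuadraticForms.exists_prescribed_normClass_sign_iff_even`).
[cite: Omeara1963, §71 Thm. 71:19] [cite: Liu2021, App. D Lem. D.1 (4)] -/
def RelabelUnit₂ : Prop :=
  ∀ (L : Type) [Field L] [NumberField L] [IsCMField L] (ι : L →+* ℂ)
    (dV : Fin 2 → L) (hdV : ∀ i, IsCMField.complexConj L (dV i) = dV i) (hdV0 : ∀ i, dV i ≠ 0),
    (∃ T : GL (Fin 2) ℂ, formCongr (starRingEnd ℂ) T ((Matrix.diagonal dV).map ι) = Matrix.diagonal ![(1 : ℂ), -1]) →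
    (∀ τ' : L →+* ℂ, InfinitePlace.mk τ' ≠ InfinitePlace.mk ι → ((Matrix.diagonal dV).map τ').PosDef) →
    4 ≤ Module.finrank ℚ L →
    ∀ a : (↥(maximalRealSubfield L))ˣ, ∃ a' : (↥(maximalRealSubfield L))ˣ,
      ∀ (hJh : ((Matrix.diagonal dV).map (IsCMField.complexConj L))ᵀ = Matrix.diagonal dV) (hJdet : (Matrix.diagonal dV).det ≠ 0)
          (v : HeightOneSpectrum (𝓞 ↥(maximalRealSubfield L))),
        locF (↥(maximalRealSubfield L)) (imagUnitSq L) a' v = locF (↥(maximalRealSubfield L)) (imagUnitSq L) a v ↔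
          LemD1.IsIsotropic (LemD1OfPlace.standingData L v (IsCMField.complexConj L) 2 (Matrix.diagonal dV)
            (complexConj_imagUnit L) (imagUnit_ne_zero L) le_rfl hJh hJdet)

/-- **A (ARITHMETIC)** — the RELABELLING PARITY: if `Φ` is admissible for `ε_a` ([Liu2021, Def. 4.12] currency of the letters) and the classes of
`a′` differ from those of `a` exactly on the anisotropic set of the registered frame, then the CONJUGATE type `Φ̄` is NOT admissible for `ε_{a′}`
(Hilbert reciprocity ★ `even_ncard_not_isIsotropic_add_finrank_sub_one` — the anisotropic count has the parity of `[L⁺:ℚ] − 1` — + the parity form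
of admissibility ★ `isAdmissible_epsOf_iff_even` + `#{φ ∈ Φ : Im φ(δ) > 0} + #{φ ∈ Φ̄ : Im φ(δ) > 0} = [L⁺:ℚ]`).  ★-adjacent:
`RemD5.not_isAdmissible_companion_of_ne_on_anisotropic` (stated there with `epsOf … (−e)`; pass through ★ `isAdmissibleElement_conj_neg_iff`, `CMTypeOps.bar_bar`).
[cite: Liu2021, Def. 4.12 (l. 2102–2108); App. D Lem. D.1 (4), §D.3] [cite: Omeara1963, §71 Thm. 71:18] -/
def RelabelParity₂ : Prop :=
  ∀ (L : Type) [Field L] [NumberField L] [IsCMField L] (ι : L →+* ℂ)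
    (dV : Fin 2 → L) (hdV : ∀ i, IsCMField.complexConj L (dV i) = dV i) (hdV0 : ∀ i, dV i ≠ 0),
    (∃ T : GL (Fin 2) ℂ, formCongr (starRingEnd ℂ) T ((Matrix.diagonal dV).map ι) = Matrix.diagonal ![(1 : ℂ), -1]) →
    (∀ τ' : L →+* ℂ, InfinitePlace.mk τ' ≠ InfinitePlace.mk ι → ((Matrix.diagonal dV).map τ').PosDef) →
    4 ≤ Module.finrank ℚ L →
    ∀ (Φ : CMType L) (a a' : (↥(maximalRealSubfield L))ˣ),
      (∀ (hJh : ((Matrix.diagonal dV).map (IsCMField.complexConj L))ᵀ = Matrix.diagonal dV) (hJdet : (Matrix.diagonal dV).det ≠ 0)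
          (v : HeightOneSpectrum (𝓞 ↥(maximalRealSubfield L))),
        locF (↥(maximalRealSubfield L)) (imagUnitSq L) a' v = locF (↥(maximalRealSubfield L)) (imagUnitSq L) a v ↔
          LemD1.IsIsotropic (LemD1OfPlace.standingData L v (IsCMField.complexConj L) 2 (Matrix.diagonal dV)
            (complexConj_imagUnit L) (imagUnit_ne_zero L) le_rfl hJh hJdet)) →
      (∃ e : L, IsAdmissibleElement L Φ.1 e ∧
          epsOf (↥(maximalRealSubfield L)) (imagUnitSq L) L (2 * imagUnit L)⁻¹ e = locF (↥(maximalRealSubfield L)) (imagUnitSq L) a) →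
      ¬ ∃ e : L, IsAdmissibleElement L (CMTypeOps.bar Φ).1 e ∧
          epsOf (↥(maximalRealSubfield L)) (imagUnitSq L) L (2 * imagUnit L)⁻¹ e = locF (↥(maximalRealSubfield L)) (imagUnitSq L) a'

/-! ## §2 The named stubs (ED. 8: G1, G2 are the ONLY `sorry`s of the file; L4if closed by name ★ `F0P5LemD14IfNonsplitLetter`; R1, A, R2G closed by name; R2′ proved from the ★ assembler on L4if.  ED. 6: G1, G2, L4, L1ns were the only `sorry`s; L1 closed from L1ns by ★ `toAllPlaces`; R2′ proved from the ★ P1 assembler on L4, L1) -/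

/-- **stub G1** (GLOBAL, typer-first: T4 multiplicity formula ∕ T5-D1). [cite: Liu2021, App. D, proof of Prop. D.4 (1) (p. 130–131)]
[cite: Rogawski1990, Thm. 11.5.1] [cite: KalethaMinguezShinWhite2014, Thm. 1.7.1] -/
theorem stub_glob_multLeOneAtThetaHol : MultLeOneAtThetaHol₂ := by
  sorry

/-- **stub G2** (GLOBAL; EDITION 9: RE-TYPED over the ORIENTED statement G2′ `PinnedHolNecessity₂'` — name kept, statement changed; payer = the LD2 organ line). 
[cite: Liu2021, App. D Rem. D.5 (p. 131); Prop. D.4 (1) and its proof; Lem. D.2 (3)] -/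
theorem stub_glob_pinnedHolNecessity : PinnedHolNecessity₂' := by
  sorry

/-- **stub R2G** (GLOBAL det-twist; CLOSED BY NAME at ED. 4: ★ `Theorems/F0P5CurveThetaCompanionDetTwistRep.lean` (B-p04 (g30)) on ★ p828480
`Theorems/F0P5CurveThetaCompanionDetTwist.lean` (B-p08 (g21)); head `stub_sl_companionDetTwist_holds` = the body of `CompanionDetTwist₂`, δ-unfolded).
[cite: Liu2021, App. D Lem. D.1 (4) (p. 126); §D.1 Step 2] [cite: GelbartRogawski1991, Prop. 3.1.1] -/
theorem stub_sl_companionDetTwist : CompanionDetTwist₂ :=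
  F0P5CurveThetaCompanionDetTwist.stub_sl_companionDetTwist_holds

/-- **stub L4if — LETTER** [Liu2021, Lem. D.1 (4)] «IF» DIRECTION, SECOND ALTERNATIVE (★ generic predicate `LemD1_4IfAsPrintedI`: for members
`i, j` of an indexed family with `Θ_i ≠ 0`, the twist relation `μ_j = μ_i·(χ_i ∘ det)`, `χ_j = χ_i`, `[ε_j] = [ε_i] ↔ V isotropic` implies `Θ_j ≅ Θ_i`),
`n = 2`, at the NON-SPLIT finite places of `L⁺`, read on the two members `(λ, a, χ)`, `(λ′, a′, χ)` (`toHeckeCharacter λ′ = (toHeckeCharacter λ)ᶜ·χ̌`) of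
the θ-package indexed family ★ `localIndexedFamilyAtV₂` (ED. 7; the fifth named Prop of ★ `Liu2021/LemD1RankTwoCMLetters.lean` ED. 3, row R2′-L; = binder
`h4if` of the ★ assembler `companionRelabelTransfer₂_of_nonsplit_if_letter`).  It is implied by the full printed (4) (★ `LemD1_4AsPrintedNonsplitCM₂.toIf`);
split places are IN-HOUSE (★ `areIsomorphicRep_localFactor_comp_localLineInl_of_split`); in print it is the rank-one theta dichotomy.
CLOSED BY NAME at ED. 8: ★ p840716 `Theorems/F0P5LemD14IfNonsplitLetter.lean` (A-p17 (g20), `lemD1_4IfAsPrintedNonsplitCM₂_holds`, hypothesis-free).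
[cite: Liu2021, App. D Lem. D.1 (4) (p. 126)] [cite: HarrisKudlaSweet1996, Thm. 6.1] -/
theorem stub_letter_lemD14_if_nonsplit : Literature.NumberTheory.Automorphic.Liu2021.LemD1RankTwoCMLetters.LemD1_4IfAsPrintedNonsplitCM₂ :=
  F0P5LemD14IfNonsplitLetter.lemD1_4IfAsPrintedNonsplitCM₂_holds

set_option maxHeartbeats 1600000 in
/-- **THE COMPOSITION R2G + R2″ ⇒ R2′ (PROVED; B-p08 (g21) draft 4ac1b8d99d63980b :228–281, verbatim)**: the companion `λ′` is ★ `IsConjugateSymplectic.exists_companion_galConj_mul_checkOfChi`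
(conjugate symplectic, weight one, `cmType = bar`); the det-twist data `α`, `χ♭` are constructed once; `j′ := T⁻¹ ∘ j″` is an injective
`σ`-intertwiner into `ω_f(λ′, ε_{a′}, χ)|_H` because `T` and `j″` satisfy the SAME scalar law `· (σ∕ρ′) = α(det k) • Ω(k) (·)`.  No twist operation on
`Representation`, no generic lemma beyond `LinearEquiv` algebra. [cite: Liu2021, App. D Lem. D.1 (4) (p. 126); Rem. 4.4] -/
theorem companionRelabelTransfer_of_detTwist_of_flip (h1 : CompanionDetTwist₂) (h2 : FlipTransferTwisted₂) :
    CompanionRelabelTransfer₂ := by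
  intro L _ _ _ ι H dV hdV hdV0 t ht g hg hsig hdef h4 n' e₁ lam hlam hw a χ W _ _ σ hirr hsm j hj a' hflip
  have hcc : IsCMField.complexConj L * IsCMField.complexConj L = 1 :=
    AlgEquiv.ext fun x => by rw [AlgEquiv.mul_apply, IsCMField.complexConj_apply_apply, AlgEquiv.one_apply]
  have hJdet : (Matrix.diagonal dV).det ≠ 0 := by
    rw [Matrix.det_diagonal]
    exact Finset.prod_ne_zero_iff.2 fun i _ => hdV0 i
  obtain ⟨lam', hH, hlam', hw', hΦ'⟩ := hlam.exists_companion_galConj_mul_checkOfChi hcc χ hw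
  -- the det-twist data `α`, `χ♭`
  let α : UnitaryGroup.adelicOne (↥(maximalRealSubfield L)) L (IsCMField.complexConj L) →* ℂˣ :=
    { toFun := fun u => (toHeckeCharacter L lam (u : Literature.NumberTheory.GaloisRepresentations.ideleGroup L))⁻¹ *
        χ.1 ⟨finitePart L (u : Literature.NumberTheory.GaloisRepresentations.ideleGroup L), finitePart_mem_finAdelicOne (↥(maximalRealSubfield L)) L (IsCMField.complexConj L) u.2⟩
      map_one' := by
        have h1 : (⟨finitePart L ((1 : UnitaryGroup.adelicOne (↥(maximalRealSubfield L)) L (IsCMField.complexConj L)) : Literature.NumberTheory.GaloisRepresentations.ideleGroup L),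
            finitePart_mem_finAdelicOne (↥(maximalRealSubfield L)) L (IsCMField.complexConj L)
              (1 : UnitaryGroup.adelicOne (↥(maximalRealSubfield L)) L (IsCMField.complexConj L)).2⟩ :
            UnitaryGroup.finAdelicOne (↥(maximalRealSubfield L)) L (IsCMField.complexConj L)) = 1 :=
          Subtype.ext (by simp only [OneMemClass.coe_one, map_one])
        rw [h1, OneMemClass.coe_one, map_one, map_one, inv_one, one_mul]
      map_mul' := fun u v => by
        have hmul : (⟨finitePart L ((u * v : UnitaryGroup.adelicOne (↥(maximalRealSubfield L)) L (IsCMField.complexConj L)) : Literature.NumberTheory.GaloisRepresentations.ideleGroup L),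
            finitePart_mem_finAdelicOne (↥(maximalRealSubfield L)) L (IsCMField.complexConj L) (u * v).2⟩ :
            UnitaryGroup.finAdelicOne (↥(maximalRealSubfield L)) L (IsCMField.complexConj L)) =
            ⟨finitePart L (u : Literature.NumberTheory.GaloisRepresentations.ideleGroup L), finitePart_mem_finAdelicOne (↥(maximalRealSubfield L)) L (IsCMField.complexConj L) u.2⟩ *
            ⟨finitePart L (v : Literature.NumberTheory.GaloisRepresentations.ideleGroup L), finitePart_mem_finAdelicOne (↥(maximalRealSubfield L)) L (IsCMField.complexConj L) v.2⟩ :=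
          Subtype.ext (by simp only [Subgroup.coe_mul, map_mul])
        rw [hmul, Subgroup.coe_mul, map_mul, map_mul, mul_inv, mul_mul_mul_comm] }
  have hα : ∀ u, α u = (toHeckeCharacter L lam (u : Literature.NumberTheory.GaloisRepresentations.ideleGroup L))⁻¹ *
      χ.1 ⟨finitePart L (u : Literature.NumberTheory.GaloisRepresentations.ideleGroup L), finitePart_mem_finAdelicOne (↥(maximalRealSubfield L)) L (IsCMField.complexConj L) u.2⟩ :=
    fun _ => rfl
  let ιf : UnitaryGroup.finAdelicOne (↥(maximalRealSubfield L)) L (IsCMField.complexConj L) →*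
      UnitaryGroup.adelicOne (↥(maximalRealSubfield L)) L (IsCMField.complexConj L) :=
    { toFun := fun v => ⟨finiteIdele L (v : (FiniteAdeleRing (𝓞 L) L)ˣ),
        finiteIdele_mem_adelicOne (↥(maximalRealSubfield L)) L (IsCMField.complexConj L) v⟩
      map_one' := Subtype.ext (Units.ext rfl)
      map_mul' := fun v w => Subtype.ext (Units.ext (Prod.ext (one_mul _).symm rfl)) }
  let χf : UnitaryGroup.finAdelicOne (↥(maximalRealSubfield L)) L (IsCMField.complexConj L) →* ℂˣ := χ.1 * ((α.comp ιf) ^ 2)⁻¹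
  have hχf : ∀ v, χf v = χ.1 v *
      (α ⟨finiteIdele L (v : (FiniteAdeleRing (𝓞 L) L)ˣ), finiteIdele_mem_adelicOne (↥(maximalRealSubfield L)) L (IsCMField.complexConj L) v⟩ ^ 2)⁻¹ :=
    fun _ => rfl
  obtain ⟨T, hT⟩ := h1 L dV hdV hdV0 hJdet hcc e₁ lam hlam χ lam' hlam' hH α hα χf hχf a'
  obtain ⟨j'', hj''inj, hj''⟩ :=
    h2 L ι H dV hdV hdV0 t ht g hg hsig hdef h4 e₁ lam hlam hw a χ W σ hirr hsm j hj a' hflip hJdet α hα χf hχf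
  refine ⟨lam', hlam', hw', hΦ', LinearMap.intertwiningMap_of_isIntertwiningMap _ _ (T.symm.toLinearMap ∘ₗ j'') ?_, ?_⟩
  · intro k w
    apply T.injective
    simp only [LinearMap.coe_comp, Function.comp_apply, LinearEquiv.coe_toLinearMap, LinearEquiv.apply_symm_apply,
      MonoidHom.coe_comp]
    rw [hj'' k w, hT, LinearEquiv.apply_symm_apply]
  · intro x y hxy
    change T.symm (j'' x) = T.symm (j'' y) at hxy
    exact hj''inj (T.symm.injective hxy)

/-- **stub R2′ — PROVED (ED. 7) FROM THE ★ ASSEMBLER ON THE ONE LETTER L4if**: ★ `Theorems/F0P5CurveThetaCompanionRelabelOfNonsplitIfLetter.lean`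
(A-p17 (g18)) `companionRelabelTransfer₂_of_nonsplit_if_letter` (letter (1)'s first sentence in-house at every place ★ p831988, A-p18 (g22)), whose conclusion is this
registered body verbatim; statement unchanged (ED. 2, F0P5-ref2 FIDELITY OK «KEEP the existential»).  (ED. 5∕6 proved it from the two letters L4, L1 by ★
`companionRelabelTransfer₂_of_nonsplit_lemD1_4`; ED. 3∕4 from R2G + R2″ by `companionRelabelTransfer_of_detTwist_of_flip`, kept above.)
[cite: Liu2021, App. D Lem. D.1 (1), (4) (p. 125–126); Rem. 4.4] [cite: HarrisKudlaSweet1996, Thm. 6.1] -/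
theorem stub_sl_companionRelabelTransfer : CompanionRelabelTransfer₂ :=
  F0P5CurveThetaCompanionRelabelOfNonsplitIfLetter.companionRelabelTransfer₂_of_nonsplit_if_letter stub_letter_lemD14_if_nonsplit

/-- **stub R1 — CLOSED BY NAME (ED. 2)**: ★ p826614 `Theorems/F0P5PaydownStubRelabelUnit.lean` (F0P5-p06 (g0); REF F0P5-ref2 FIDELITY OK).
[cite: Omeara1963, §71 Thm. 71:19] [cite: Liu2021, App. D Lem. D.1 (4) (p. 126)] -/
theorem stub_arith_relabelUnit : RelabelUnit₂ :=
  F0P5PaydownStubRelabelUnit.stub_arith_relabelUnit_holds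

/-- **stub A — CLOSED BY NAME (ED. 2)**: ★ p826681 `Theorems/F0P5CurveThetaStubRelabelParity.lean` (F0P5-p07 (g0); REF F0P5-ref2 FIDELITY OK;
★ `RemD5.not_isAdmissible_companion_of_ne_on_anisotropic` at `Φ̄`). [cite: Liu2021, Def. 4.12; App. D §D.3] [cite: Omeara1963, §71 Thm. 71:18] -/
theorem stub_arith_relabelParity : RelabelParity₂ :=
  F0P5CurveThetaStubRelabelParity.relabelParity_holds

/-! ## §3 The glue (PROVED): the heads BY NAME from the stubs, then the same compositions as sorry-free implications -/

/-- **HEAD #74R BY NAME (EDITION 9: the ORIENTED letter ★ `curveThetaHodgeTypeNecessity_hol_pos`, p848618) — from G2′ (stub G2 re-typed), R2′, R1 (★), A (★)** ([Liu2021, Rem. D.5] necessity for an unpinned label): if `e♮ ∉ Φ_λ`, relabel the finite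
component to `(λ′, ε_{a′}, χ)` with `Φ_{λ′} = Φ̄_λ ∋ e♮` (R1 the unit `a′`, R2′ the companion `λ′`, in print `λᶜ·χ̌`); the pinned necessity G2 makes `Φ̄_λ`
admissible for `ε_{a′}`, against A.  `sorry` only via the named stubs G2, R2′. [cite: Liu2021, App. D Rem. D.5; Lem. D.1 (4); Def. 4.12] -/
theorem curveThetaHodgeTypeNecessity_hol_pos_holds : curveThetaHodgeTypeNecessity_hol_pos := by
  intro L _ _ _ ι H dV hdV hdV0 t ht hτt hτt' g hg hsig hdef h4 𝔣 μ _ n' e₁ lam hlam hw a χ W _ _ σ hirr hsm j hj P hP hfin hadm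
  by_contra hnot
  obtain ⟨a', hflip⟩ := stub_arith_relabelUnit L ι dV hdV hdV0 hsig hdef h4 a
  obtain ⟨lam', hlam', hw', hΦ', j', hj'⟩ :=
    stub_sl_companionRelabelTransfer L ι H dV hdV hdV0 t ht g hg hsig hdef h4 e₁ lam hlam hw a χ W σ hirr hsm j hj a' hflip
  have hpin' : (cmPlace L ι).1.embedding ∈ hlam'.cmType.1 := by
    rw [hΦ']
    exact (CMTypeOps.mem_bar_iff _ _).mpr hnot
  have hadm' := stub_glob_pinnedHolNecessity L ι H dV hdV hdV0 t ht hτt hτt' g hg hsig hdef h4 𝔣 μ e₁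
    lam' hlam' hw' a' χ W σ hirr hsm j' hj' hpin' P hP hfin
  rw [hΦ'] at hadm'
  exact stub_arith_relabelParity L ι dV hdV hdV0 hsig hdef h4 hlam.cmType a a' hflip hadm hadm'

/-- **HEAD #73 BY NAME — from G1**: the SPEC ED. 11 v2.1 fold `stub_S1_facts_of_multLeOneAtThetaHol` (θ-restricted twin of ★
`E1TwoFaces.curveCohFinComponentUnique_hol_of_multiplicity`: ★ `E1pRealise.archCoefficient_shape` ∕ `holValued_shape`, ★ `E2LevelFinite.admissibleOfHolValued₂_holds`,
★ `E1pOfE1.eq_of_discIdentity_of_holRealised`).  `sorry` only via `stub_glob_multLeOneAtThetaHol`. [cite: Liu2021, App. D, proof of Prop. D.4 (1) (p. 130–131)] -/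
theorem curveThetaCohFinComponentUnique_hol_holds : curveThetaCohFinComponentUnique_hol := by
  intro L _ _ _ ι H dV hdV hdV0 t ht g hg hsig hdef h4 𝔣 μ _ n' e₁ lam hlam hw a χ W _ _ σ hirr hsm j hj P P' hP hP' hPσ hP'σ
  obtain ⟨τ, hτ⟩ := UnitaryGroup.exists_infinitePlace_ne L h4 ι
  have hanis := S1BettiSliceExclusion.anisotropic_of_formCongr_posDef L H t g dV hg τ (hdef τ hτ)
  haveI := UnitaryGroup.compactSpace_adelicGroupData_automorphicQuotient L 2 H hanis
  obtain ⟨m, hm'⟩ := E1pRealise.archCoefficient_shape L ι H dV hdV hdV0 t ht g hg hsig hdef h4 𝔣 μ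
  obtain ⟨ψ, hE, hV, hne⟩ := E1pRealise.holValued_shape L ι H dV hdV hdV0 t ht g hg hsig hdef h4 𝔣 μ W σ hirr hsm P hP hPσ
  obtain ⟨ψ', hE', hV', hne'⟩ := E1pRealise.holValued_shape L ι H dV hdV hdV0 t ht g hg hsig hdef h4 𝔣 μ W σ hirr hsm P' hP' hP'σ
  have hadm : σ.IsAdmissible :=
    E2LevelFinite.admissibleOfHolValued₂_holds L ι H dV hdV hdV0 t ht g hg hsig hdef h4 𝔣 μ P W σ hirr hsm ψ hE hV hne
  exact E1pOfE1.eq_of_discIdentity_of_holRealised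
    (stub_glob_multLeOneAtThetaHol L ι H dV hdV hdV0 t ht g hg hsig hdef h4 𝔣 μ e₁ lam hlam hw a χ W σ hirr hsm j hj P hP hPσ)
    m hm' σ hirr hadm ψ hE hV hne ψ' hE' hV' hne'

/-- **CERTIFICATE #74** — «the four stub STATEMENTS imply letter #74», as ONE closed `Prop` (so that exactly one theorem of the file concludes the
letter decl itself: the head above). [cite: Liu2021, App. D Rem. D.5; Lem. D.1 (4); Def. 4.12] -/
def PaydownCertificate₇₄ : Prop :=
  PinnedHolNecessity₂ → CompanionRelabelTransfer₂ → RelabelUnit₂ → RelabelParity₂ → curveThetaHodgeTypeNecessity_hol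

/-- **#74 from the four stub STATEMENTS** — the same glue as an implication; kernel-checked WITHOUT `sorry` (axioms `propext`, `Classical.choice`,
`Quot.sound`): the certificate that the cut is complete. [cite: Liu2021, App. D Rem. D.5; Lem. D.1 (4); Def. 4.12] -/
theorem paydownCertificate₇₄ : PaydownCertificate₇₄ := by
  intro hG2 hR2 hR1 hA L _ _ _ ι H dV hdV hdV0 t ht g hg hsig hdef h4 𝔣 μ _ n' e₁ lam hlam hw a χ W _ _ σ hirr hsm j hj P hP hfin hadm
  by_contra hnot
  obtain ⟨a', hflip⟩ := hR1 L ι dV hdV hdV0 hsig hdef h4 a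
  obtain ⟨lam', hlam', hw', hΦ', j', hj'⟩ := hR2 L ι H dV hdV hdV0 t ht g hg hsig hdef h4 e₁ lam hlam hw a χ W σ hirr hsm j hj a' hflip
  have hpin' : (cmPlace L ι).1.embedding ∈ hlam'.cmType.1 := by
    rw [hΦ']
    exact (CMTypeOps.mem_bar_iff _ _).mpr hnot
  have hadm' := hG2 L ι H dV hdV hdV0 t ht g hg hsig hdef h4 𝔣 μ e₁ lam' hlam' hw' a' χ W σ hirr hsm j' hj' hpin' P hP hfin
  rw [hΦ'] at hadm'
  exact hA L ι dV hdV hdV0 hsig hdef h4 hlam.cmType a a' hflip hadm hadm'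

/-- **CERTIFICATE #74 THROUGH THE ED. 3 LEAVES** — «G2, R2G, R2″, R1, A imply letter #74»; kernel-checked WITHOUT `sorry`.
[cite: Liu2021, App. D Rem. D.5; Lem. D.1 (4); Def. 4.12] -/
def PaydownCertificate₇₄Leaves : Prop :=
  PinnedHolNecessity₂ → CompanionDetTwist₂ → FlipTransferTwisted₂ → RelabelUnit₂ → RelabelParity₂ → curveThetaHodgeTypeNecessity_hol

/-- the leaf certificate, from `paydownCertificate₇₄` and the proved composition. [cite: Liu2021, App. D Rem. D.5; Lem. D.1 (4)] -/
theorem paydownCertificate₇₄Leaves : PaydownCertificate₇₄Leaves :=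
  fun hG2 hR2G hR2'' hR1 hA => paydownCertificate₇₄ hG2 (companionRelabelTransfer_of_detTwist_of_flip hR2G hR2'') hR1 hA

/-- **CERTIFICATE #74 THROUGH THE ED. 5 LEAVES** — «G2, the letters L4 and L1, R1, A imply letter #74»; kernel-checked WITHOUT `sorry`
(the R2′ slot is the ★ P1 assembler). [cite: Liu2021, App. D Rem. D.5; Lem. D.1 (1), (4); Def. 4.12] -/
def PaydownCertificate₇₄Letters : Prop :=
  PinnedHolNecessity₂ → Literature.NumberTheory.Automorphic.Liu2021.LemD1RankTwoCMLetters.LemD1_4AsPrintedNonsplitCM₂ →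
    Literature.NumberTheory.Automorphic.Liu2021.LemD1RankTwoCMLetters.LemD1_1AsPrintedCM₂ → RelabelUnit₂ → RelabelParity₂ →
      curveThetaHodgeTypeNecessity_hol

/-- the letter certificate, from `paydownCertificate₇₄` and the ★ P1 assembler. [cite: Liu2021, App. D Rem. D.5; Lem. D.1 (1), (4)] -/
theorem paydownCertificate₇₄Letters : PaydownCertificate₇₄Letters :=
  fun hG2 h4 h1 hR1 hA =>
    paydownCertificate₇₄ hG2 (F0P5CurveThetaCompanionRelabelOfLocalFactors.companionRelabelTransfer₂_of_nonsplit_lemD1_4 h4 h1) hR1 hA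

/-- **CERTIFICATE #74 THROUGH THE ED. 6 LEAVES** — «G2, the NON-SPLIT letters L4 and L1ns, R1, A imply letter #74»; kernel-checked WITHOUT `sorry`
(split places of item (1) in-house ★ `toAllPlaces`). [cite: Liu2021, App. D Rem. D.5; Lem. D.1 (1), (4); Def. 4.12] -/
def PaydownCertificate₇₄LettersNonsplit : Prop :=
  PinnedHolNecessity₂ → Literature.NumberTheory.Automorphic.Liu2021.LemD1RankTwoCMLetters.LemD1_4AsPrintedNonsplitCM₂ →
    Literature.NumberTheory.Automorphic.Liu2021.LemD1RankTwoCMLetters.LemD1_1AsPrintedNonsplitCM₂ → RelabelUnit₂ → RelabelParity₂ →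
      curveThetaHodgeTypeNecessity_hol

/-- the non-split letter certificate, from `paydownCertificate₇₄Letters` and ★ `LemD1_1AsPrintedNonsplitCM₂.toAllPlaces`.
[cite: Liu2021, App. D Rem. D.5; Lem. D.1 (1), (4)] -/
theorem paydownCertificate₇₄LettersNonsplit : PaydownCertificate₇₄LettersNonsplit :=
  fun hG2 h4 h1 hR1 hA =>
    paydownCertificate₇₄Letters hG2 h4 (Literature.NumberTheory.Automorphic.Liu2021.LemD1RankTwoCMLetters.LemD1_1AsPrintedNonsplitCM₂.toAllPlaces h1) hR1 hA

/-- **CERTIFICATE #74 THROUGH THE ED. 7 LEAVES** — «G2, the ONE non-split letter L4if, R1, A imply letter #74»; kernel-checked WITHOUT `sorry`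
(letter (1) eliminated: its first sentence is in-house at every place ★ p831988). [cite: Liu2021, App. D Rem. D.5; Lem. D.1 (4); Def. 4.12]
[cite: HarrisKudlaSweet1996, Thm. 6.1] -/
def PaydownCertificate₇₄IfLetter : Prop :=
  PinnedHolNecessity₂ → Literature.NumberTheory.Automorphic.Liu2021.LemD1RankTwoCMLetters.LemD1_4IfAsPrintedNonsplitCM₂ → RelabelUnit₂ → RelabelParity₂ →
    curveThetaHodgeTypeNecessity_hol

/-- the one-letter certificate, from `paydownCertificate₇₄` and the ★ assembler `companionRelabelTransfer₂_of_nonsplit_if_letter`.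
[cite: Liu2021, App. D Rem. D.5; Lem. D.1 (4)] -/
theorem paydownCertificate₇₄IfLetter : PaydownCertificate₇₄IfLetter :=
  fun hG2 h4if hR1 hA =>
    paydownCertificate₇₄ hG2 (F0P5CurveThetaCompanionRelabelOfNonsplitIfLetter.companionRelabelTransfer₂_of_nonsplit_if_letter h4if) hR1 hA

/-- monotonicity of the leaves: the ED. 6 non-split letters imply #74 through the ED. 7 certificate (★ `LemD1_4AsPrintedNonsplitCM₂.toIf`; letter (1) unused).
[cite: Liu2021, App. D Lem. D.1 (4)] -/
theorem paydownCertificate₇₄LettersNonsplit_of_ifLetter : PaydownCertificate₇₄LettersNonsplit :=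
  fun hG2 h4 _h1 hR1 hA => paydownCertificate₇₄IfLetter hG2 (Literature.NumberTheory.Automorphic.Liu2021.LemD1RankTwoCMLetters.LemD1_4AsPrintedNonsplitCM₂.toIf h4) hR1 hA

/-- **CERTIFICATE #74R (EDITION 9)** — «G2′, R2′, R1, A imply the ORIENTED letter #74R ★ `curveThetaHodgeTypeNecessity_hol_pos`», as ONE closed `Prop`;
the ED. 1–8 certificates above (concluding the unsigned #74 from the unsigned G2) stay as true implications between settled negative edges.
[cite: Liu2021, App. D Rem. D.5; Lem. D.1 (4); Def. 4.12] -/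
def PaydownCertificate₇₄R : Prop :=
  PinnedHolNecessity₂' → CompanionRelabelTransfer₂ → RelabelUnit₂ → RelabelParity₂ → curveThetaHodgeTypeNecessity_hol_pos

/-- **#74R from the four stub STATEMENTS (G2′, R2′, R1, A)** — kernel-checked WITHOUT `sorry`; R2′ ∕ R1 ∕ A are orientation-free, G2′ receives the two binders.
[cite: Liu2021, App. D Rem. D.5; Lem. D.1 (4); Def. 4.12] -/
theorem paydownCertificate₇₄R : PaydownCertificate₇₄R := by
  intro hG2 hR2 hR1 hA L _ _ _ ι H dV hdV hdV0 t ht hτt hτt' g hg hsig hdef h4 𝔣 μ _ n' e₁ lam hlam hw a χ W _ _ σ hirr hsm j hj P hP hfin hadm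
  by_contra hnot
  obtain ⟨a', hflip⟩ := hR1 L ι dV hdV hdV0 hsig hdef h4 a
  obtain ⟨lam', hlam', hw', hΦ', j', hj'⟩ := hR2 L ι H dV hdV hdV0 t ht g hg hsig hdef h4 e₁ lam hlam hw a χ W σ hirr hsm j hj a' hflip
  have hpin' : (cmPlace L ι).1.embedding ∈ hlam'.cmType.1 := by
    rw [hΦ']
    exact (CMTypeOps.mem_bar_iff _ _).mpr hnot
  have hadm' := hG2 L ι H dV hdV hdV0 t ht hτt hτt' g hg hsig hdef h4 𝔣 μ e₁ lam' hlam' hw' a' χ W σ hirr hsm j' hj' hpin' P hP hfin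
  rw [hΦ'] at hadm'
  exact hA L ι dV hdV hdV0 hsig hdef h4 hlam.cmType a a' hflip hadm hadm'

/-- **CERTIFICATE #74R THROUGH THE ED. 7 LEAVES (EDITION 9)** — «G2′, the ONE non-split letter L4if, R1, A imply #74R»; kernel-checked WITHOUT `sorry`.
[cite: Liu2021, App. D Rem. D.5; Lem. D.1 (4); Def. 4.12] [cite: HarrisKudlaSweet1996, Thm. 6.1] -/
def PaydownCertificate₇₄RIfLetter : Prop :=
  PinnedHolNecessity₂' → Literature.NumberTheory.Automorphic.Liu2021.LemD1RankTwoCMLetters.LemD1_4IfAsPrintedNonsplitCM₂ → RelabelUnit₂ → RelabelParity₂ →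
    curveThetaHodgeTypeNecessity_hol_pos

/-- the one-letter certificate for #74R, from `paydownCertificate₇₄R` and the ★ assembler `companionRelabelTransfer₂_of_nonsplit_if_letter`.
[cite: Liu2021, App. D Rem. D.5; Lem. D.1 (4)] -/
theorem paydownCertificate₇₄RIfLetter : PaydownCertificate₇₄RIfLetter :=
  fun hG2 h4if hR1 hA =>
    paydownCertificate₇₄R hG2 (F0P5CurveThetaCompanionRelabelOfNonsplitIfLetter.companionRelabelTransfer₂_of_nonsplit_if_letter h4if) hR1 hA

/-- **CERTIFICATE #73** — «the stub STATEMENT G1 implies letter #73», as ONE closed `Prop`. [cite: Liu2021, App. D, proof of Prop. D.4 (1)] -/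
def PaydownCertificate₇₃ : Prop :=
  MultLeOneAtThetaHol₂ → curveThetaCohFinComponentUnique_hol

/-- **#73 from the stub STATEMENT G1** — the same fold as an implication; kernel-checked WITHOUT `sorry`. [cite: Liu2021, App. D, proof of Prop. D.4 (1)] -/
theorem paydownCertificate₇₃ : PaydownCertificate₇₃ := by
  intro hm L _ _ _ ι H dV hdV hdV0 t ht g hg hsig hdef h4 𝔣 μ _ n' e₁ lam hlam hw a χ W _ _ σ hirr hsm j hj P P' hP hP' hPσ hP'σ
  obtain ⟨τ, hτ⟩ := UnitaryGroup.exists_infinitePlace_ne L h4 ι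
  have hanis := S1BettiSliceExclusion.anisotropic_of_formCongr_posDef L H t g dV hg τ (hdef τ hτ)
  haveI := UnitaryGroup.compactSpace_adelicGroupData_automorphicQuotient L 2 H hanis
  obtain ⟨m, hm'⟩ := E1pRealise.archCoefficient_shape L ι H dV hdV hdV0 t ht g hg hsig hdef h4 𝔣 μ
  obtain ⟨ψ, hE, hV, hne⟩ := E1pRealise.holValued_shape L ι H dV hdV hdV0 t ht g hg hsig hdef h4 𝔣 μ W σ hirr hsm P hP hPσ
  obtain ⟨ψ', hE', hV', hne'⟩ := E1pRealise.holValued_shape L ι H dV hdV hdV0 t ht g hg hsig hdef h4 𝔣 μ W σ hirr hsm P' hP' hP'σ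
  have hadm : σ.IsAdmissible :=
    E2LevelFinite.admissibleOfHolValued₂_holds L ι H dV hdV hdV0 t ht g hg hsig hdef h4 𝔣 μ P W σ hirr hsm ψ hE hV hne
  exact E1pOfE1.eq_of_discIdentity_of_holRealised (hm L ι H dV hdV hdV0 t ht g hg hsig hdef h4 𝔣 μ e₁ lam hlam hw a χ W σ hirr hsm j hj P hP hPσ)
    m hm' σ hirr hadm ψ hE hV hne ψ' hE' hV' hne'

/-! ## §4 The crux BY NAME through the line of record (consumed BY TYPE, not by import) -/

/-- **`HLiu418` through the line of record.**  `Lines/F0_AlbCm.lean` ED. 10 (2daec4b8a272) proves the crux `HLiu418` from its three open stubs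
`stub_S1_facts` (#73), `stub_S1b_facts` (#74R since `F0_AlbCm` ED. 11; #74 before), `stub_D9op` (MOD, human-gated; head of `Lines/F0_D9opRoad2`); this pay-down line supplies the first two
BY NAME.  As in `F0_AlbCm` :34 the sibling Lines module is consumed BY TYPE, not by import: `hF0` is (the `stub_D9op`-instantiated) composition
`HLiu418_of_F0` of the line of record, read as a function of the two letters.  `skeleton.extra-hypothesis` by design (the MOD stub is not this line's).
HC_CM is proved only modulo the printed citations until rung 0 closes. [cite: Liu2021, App. D Prop. D.4 (1), Rem. D.5, Cor. D.9] -/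
theorem HLiu418_proof
    (hF0 : curveThetaCohFinComponentUnique_hol → curveThetaHodgeTypeNecessity_hol_pos →
      Summit.HodgeConjecture.HodgeConjecture.Theses.HCCMUnconditional.HLiu418) :
    Summit.HodgeConjecture.HodgeConjecture.Theses.HCCMUnconditional.HLiu418 :=
  hF0 curveThetaCohFinComponentUnique_hol_holds curveThetaHodgeTypeNecessity_hol_pos_holds

end Summit.HodgeConjecture.HodgeConjecture.Cruxes.HLiu418.F0P5CurveThetaLettersPaydown

end
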